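import Literature.NumberTheory.EllipticCurves.TwoVariablePadicLFunction
import Literature.NumberTheory.EllipticCurves.NewformsLevelRaising
import Literature.NumberTheory.EllipticCurves.PeriodRationalityProofs
import Literature.NumberTheory.EllipticCurves.PeriodRationalityCorrectedProofs
import Literature.NumberTheory.EllipticCurves.NewformsCoeffFieldHolds
import Literature.FieldTheory.AlgClosed.PadicAlgClEquivComplex
import Literature.FieldTheory.AlgClosed.AutomorphismExtension
import Literature.NumberTheory.EllipticCurves.PAdicLFunctionProofs
import Literature.NumberTheory.EllipticCurves.AnalyticRankProofs
import HarnessLib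

/-!
# The Greenberg–Stevens / Kitagawa value–norm interpolation: the classical glue (proofs only)

Topic `Literature/NumberTheory/EllipticCurves`.  THEOREMS ONLY (no definition, no named fact; D-0026).
A proofs-only companion of the named fact
`Literature.NumberTheory.EllipticCurves.greenbergStevens_kitagawa_twoVariable_interpolation`
(`TwoVariablePadicLFunction.lean`; Greenberg–Stevens 1993, §5; Kitagawa 1994, Thm. 1.1 with
Prop. 5.12; in the form recalled by Delbourgo 2008, Thm. 4.11, Def. 4.12, p. 100).

**What the fact needs and where it stands.**  The printed derivation of the fact (its docstring,
items (i)–(vi)) has a `Λ`-adic core and a classical glue: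

* core (absent from Mathlib and from the tree): Hida's ordinary `Λ`-adic Hecke algebra of tame level
  `Γ₀(N)` — freeness over `Λ = ℤ_p⟦1 + pℤ_p⟧` for `p ≥ 5` and the control theorem
  `𝕋/P_k𝕋 ≅ h_k^{ord}(Γ₀(Np); ℤ_p)` (Hida 1986; Delbourgo Thm. 4.4; Hida, *Elementary Modular Iwasawa
  Theory*, Thm. 4.1.29, Cor. 4.1.30), which with the isolation hypothesis (Br) gives `𝕀 = 𝕋_𝔪 = Λ`;
  and Kitagawa's `𝕀`-adic modular symbols with the two-variable measure `μ_𝐟` and its interpolation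
  formula at the arithmetic points (Kitagawa 1994, Prop. 5.7, Thm. 5.3, Lemma 5.11, Prop. 5.12,
  Thm. 1.1 = Delbourgo Cor. 4.8, Def. 4.9, Prop. 4.10, Thm. 4.11) — the same missing `Λ`-adic layer
  that `HidaFamilyMembersProofs.lean` isolates as the hypothesis `hHida` of
  `hida_exists_congruent_ordinary_newform_of_exists_isNewformOf_of_lambdaAdic`;
* glue (classical; this file): Delbourgo's Thm. 4.11 is an identity for the `p`-STABILISED member
  `𝐟_{P_k} = g^{(α)} = g(z) − β g(pz)` (`β = p^{k−1}/α`) of the family, whereas the fact is phrased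
  with the newform `g ∈ S_k(Γ₀(N))` itself; the passage is the Euler factor
  `Λ(g^{(α)}, n) = (1 − p^{k−1−n}/α) Λ(g, n)` of item (iii) of the docstring — the second factor of
  `e = (1 − p^{n−1}/α)(1 − p^{(k−1)−n}/α)` (cf. Delbourgo Thm. 2.2, where both factors are printed
  for a newform of level prime to `p`).

**What this file PROVES.**  With the tree's degeneracy maps `ι_d` (`iota`, `NewformsLevelRaising.lean`:
`(ι_d f)(τ) = f(dτ)`, `coe_iota_apply`), the tree's completed critical values
`Λ(f, n) = completedLValue f n = ∫₀^∞ f(it) t^{n−1} dt` (`PeriodRationality.lean`) and the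
`p`-stabilisation in the shape produced by `exists_ordinary_pStabilised_of_isNewform0`
(`HidaFamilyMembersProofs.lean`: `F = ι_1 f − (a_p − u) ι_p f`, `u (a_p − u) = p^{k−1}`):

* `completedLValue_smul`, `completedLValue_sub` — linearity of `Λ(·, n)` (the second under
  integrability of the Mellin integrands, `integrableOn_mellin`);
* `completedLValue_iota` — `Λ(ι_d f, n) = d^{−n} Λ(f, n)` for `0 < n` (substitution `t ↦ dt` in the
  Mellin integral; no integrability needed);
* `completedLValue_pStabilisation` — `Λ(ι_1 f − c • ι_p f, n) = (1 − c p^{−n}) Λ(f, n)`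
  (`f ∈ S_k(Γ₀(N))`, `k ≥ 2`, `0 < n`);
* `completedLValue_pStabilisation_unitRoot` — for `u ≠ 0` with `u² − a_p u + p^{k−1} = 0`:
  `Λ(ι_1 f − (a_p − u) • ι_p f, n) = (1 − p^{k−1−n}/u) Λ(f, n)`, i.e. `L(g^{(α)}, s) =
  (1 − p^{k−1−s}/α) L(g, s)` at the critical integers, as used in item (iii) of the fact's docstring;
* `exists_ringEquiv_symm_apply_eq_of_mk_le_aleph0`, `IsNewform0.exists_ringEquiv_symm_apply_eq` —
  every embedding `ι : K_g →+* ℚ̄_p` of the coefficient field of a newform is the restriction of a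
  field isomorphism `ι₀⁻¹ : ℂ ≃ ℚ̄_p` (Steinitz + conjugacy of embeddings of countable fields,
  `Literature.FieldTheory.AlgClosed`); this matches the printed "fix `ι_∞`, `ι_p`" with the tree's
  arbitrary `ι`;
* `two_pi_pow_eq_of_odd`, `criticalValue_conversion_of_odd` — the period bookkeeping of item (iii):
  `(1 − ⋯)(2π)^n Λ/((2πi)^{n−1} Ω) = (1 − ⋯) · (iⁿΛ/ω) · r` with `r = −2πi ω/Ω` independent of `n`;
* `exists_ne_zero_forall_eq_mul_of_algebraMap` — descent of the weight-`2` proportionality constant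
  from `ℚ̄_p` to `ℚ_p`;
* `greenbergStevens_kitagawa_twoVariable_interpolation_of_core` — the **conditional assembly**: the
  named fact FOLLOWS from one explicit hypothesis `hcore`, the `Λ`-adic core of the printed derivation
  read in classical coordinates (Delbourgo Thm. 4.11 at `P_k`, `ψ = 𝟙`, `(p−1) ∣ j`, for the weight-`k`
  member identified — Hida, `𝕋_𝔪 = Λ` — with the `p`-stabilisation of every congruent ordinary newform
  `g`, plus the p. 100 display at `k = 2` read against the tree's `padicLFunction`); see its docstring
  for the clause-by-clause provenance.  `hcore` is NOT a fact of the tree and is not vendored (D-0026);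
  the theorem pins down exactly what the missing `Λ`-adic theory (Hida 1986; Kitagawa 1994) must
  deliver and proves that nothing else is missing.
* `core_of_hidaFamily_of_kitagawa`,
  `greenbergStevens_kitagawa_twoVariable_interpolation_of_hidaFamily_of_kitagawa` — the **separation
  of `hcore` into its two published halves**, read through the `Λ`-adic `q`-expansion family
  `A : ℕ → ℤ_p⟦X⟧` of the branch (Delbourgo §4.2; Wiles 1988 §1.2): `hHida` (Hida 1986 control and
  freeness with (Br), `𝕋_𝔪 = Λ`: the family through `f_E^{(α_E)}` exists, has classical
  `p`-stabilised-newform members in every weight `k ≡ 2 (mod p−1)`, and contains every congruent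
  ordinary newform) and `hKitagawa` (Kitagawa 1994 Thm. 1.1 / Greenberg–Stevens §5 / Delbourgo
  Thm. 4.11 and p. 100 for that family), with the unit-root congruence of item (iv) now PROVED from
  the analyticity of `A_p` (`norm_padicEval_sub_constantCoeff_lt_one`,
  `qExpansion_coeff_pStabilisation_self`).
* `two_pi_pow_mul_div_eq_im_div`, `kitagawa_of_patching`,
  `greenbergStevens_kitagawa_twoVariable_interpolation_of_hidaFamily_of_patching` — `hKitagawa` with
  its interpolation clause rewritten in the normalisation of the weight-`k` Mazur–Tate–Teitelbaum
  fibre, which is now PROVED in the tree (`Literature.NumberTheory.EllipticCurves.MazurTateTeitelbaumWeightK`,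
  `…WeightKMember`, `exists_mtt_powerSeries_weightK_member'`: for every `ι₀`-rational ordinary member a
  bounded `L_k ∈ ℚ_p⟦T⟧` with `L_k((1+p)^{n−1} − 1) = ι₀⁻¹((1 − p^{n−1}/u)(1 − p^{k−1−n}/u)·Im(iⁿΛ(g,n))/Ω⁻_g)`);
  the residue `hPatch` is thus exactly the two-variable PATCHING of these rows (Greenberg–Stevens
  Thm. 5.13 `ρ_k(μ_*) = λ(k)μ_{F_k}`; Kitagawa Thm. 1.1) together with the weight-`2` row.

## References
* R. Greenberg, G. Stevens, *p-adic L-functions and p-adic periods of modular forms*, Invent. Math.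
  111 (1993) 407–447, §5. [GreenbergStevens1993]
* K. Kitagawa, *On standard p-adic L-functions of families of elliptic cusp forms*, Contemp. Math.
  165 (1994) 81–110, Thm. 1.1, Prop. 5.12. [Kitagawa1994]
* D. Delbourgo, *Elliptic Curves and Big Galois Representations*, LMS LNS 356 (2008), Thm. 2.2
  (PDF p. 41), §4.2 (pp. 89–91), Thm. 4.4 (p. 90), Cor. 4.8 (p. 96), Def. 4.9–Prop. 4.10 (p. 97),
  Thm. 4.11 (pp. 98–99), Def. 4.12 (p. 99), p. 100. [Delbourgo2008]
* H. Hida, *Galois representations into `GL₂(ℤ_p⟦X⟧)` attached to ordinary cusp forms*, Invent. Math.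
  85 (1986) 545–613; *Iwasawa modules attached to congruences of cusp forms*, Ann. Sci. ÉNS 19
  (1986) 231–273. [Hida1986]
* M. Emerton, R. Pollack, T. Weston, *Variation of Iwasawa invariants in Hida families*, Invent.
  Math. 163 (2006), Thm. 2.1.2, Thm. 2.2.2. [EmertonPollackWeston2005]
* A. Wiles, *On ordinary λ-adic representations associated to modular forms*, Invent. Math. 94
  (1988), §1.2. [Wiles1988]
-/

noncomputable section

open MeasureTheory Set Complex UpperHalfPlane CongruenceSubgroup Cardinal
open scoped MatrixGroups ModularForm

namespace Literature.NumberTheory.EllipticCurves.ModularForms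

/-! ### Linearity of the completed critical values -/

section Linear

variable {Γ : Subgroup (GL (Fin 2) ℝ)} [Γ.HasDetOne] {k : ℤ}

/-- `Λ(c • f, n) = c Λ(f, n)` (no integrability needed). [folklore] -/
theorem completedLValue_smul (c : ℂ) (f : CuspForm Γ k) (n : ℕ) :
    completedLValue (c • f) n = c * completedLValue f n := by
  rw [completedLValue_def, completedLValue_def, ← integral_const_mul]
  refine setIntegral_congr_fun measurableSet_Ioi fun t _ => ?_
  simp only [CuspForm.IsGLPos.smul_apply, smul_eq_mul]
  ring

omit [Γ.HasDetOne] in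
/-- `Λ(f − g, n) = Λ(f, n) − Λ(g, n)` when both Mellin integrands are integrable. [folklore] -/
theorem completedLValue_sub (f g : CuspForm Γ k) (n : ℕ)
    (hf : IntegrableOn (fun t : ℝ ↦ ((t : ℂ) ^ (n - 1)) * f (ofComplex ((t : ℂ) * Complex.I))) (Ioi 0))
    (hg : IntegrableOn (fun t : ℝ ↦ ((t : ℂ) ^ (n - 1)) * g (ofComplex ((t : ℂ) * Complex.I))) (Ioi 0)) :
    completedLValue (f - g) n = completedLValue f n - completedLValue g n := by
  rw [completedLValue_def, completedLValue_def, completedLValue_def, ← integral_sub hf hg]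
  refine setIntegral_congr_fun measurableSet_Ioi fun t _ => ?_
  simp only [CuspForm.sub_apply]
  ring

end Linear

/-! ### The degeneracy map `ι_d` rescales the Mellin integral -/

section Iota

variable {M L d : ℕ} [NeZero d] {k : ℤ}

/-- On the imaginary axis `ι_d` is the dilation `t ↦ dt`: `(ι_d f)(it) = f(i d t)` for `t > 0`.
[folklore] -/
theorem iota_apply_imagAxis (h : M * d ∣ L) (f : CuspForm (Gamma0 M) k) {t : ℝ} (ht : 0 < t) :
    iota M L d k h f (ofComplex ((t : ℂ) * Complex.I)) = f (ofComplex (((d * t : ℝ) : ℂ) * Complex.I)) := by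
  have hd : (0 : ℝ) < d := Nat.cast_pos.mpr (NeZero.pos d)
  have him : 0 < ((t : ℂ) * Complex.I).im := by simpa using ht
  have him' : 0 < ((((d * t : ℝ)) : ℂ) * Complex.I).im := by simpa using mul_pos hd ht
  rw [coe_iota_apply, ofComplex_apply_of_im_pos him']
  congr 1
  ext1
  simp only [ofComplex_apply_of_im_pos him, UpperHalfPlane.coe_mk]
  push_cast
  ring

/-- **`Λ(ι_d f, n) = d^{−n} Λ(f, n)`** for `0 < n`: the substitution `t ↦ dt` in
`∫₀^∞ f(i d t) t^{n−1} dt` (Mathlib `integral_comp_mul_left_Ioi`; both sides are the junk value `0`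
together when the integrals diverge, so no integrability hypothesis is needed). [folklore] -/
theorem completedLValue_iota (h : M * d ∣ L) (f : CuspForm (Gamma0 M) k) {n : ℕ} (hn : 0 < n) :
    completedLValue (iota M L d k h f) n = ((d : ℂ) ^ n)⁻¹ * completedLValue f n := by
  have hd : (0 : ℝ) < d := Nat.cast_pos.mpr (NeZero.pos d)
  have hd0 : (d : ℂ) ≠ 0 := by exact_mod_cast (NeZero.ne d)
  -- the integrand of `Λ(ι_d f, n)` is `G (d t)` with `G u = (u/d)^{n-1} f(iu)`
  set G : ℝ → ℂ := fun u ↦ ((u : ℂ) / d) ^ (n - 1) * f (ofComplex ((u : ℂ) * Complex.I)) with hG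
  have hint : completedLValue (iota M L d k h f) n = ∫ t in Ioi (0 : ℝ), G (d * t) := by
    rw [completedLValue_def]
    refine setIntegral_congr_fun measurableSet_Ioi fun t ht => ?_
    simp only [hG, iota_apply_imagAxis h f ht]
    push_cast
    rw [mul_div_cancel_left₀ _ hd0]
  rw [hint, integral_comp_mul_left_Ioi G 0 hd, mul_zero, completedLValue_def, ← integral_const_mul]
  rw [show ((d : ℝ)⁻¹ • ∫ u in Ioi (0 : ℝ), G u) = ((d : ℂ)⁻¹ : ℂ) * ∫ u in Ioi (0 : ℝ), G u by
    rw [Complex.real_smul]; push_cast; ring]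
  rw [← integral_const_mul]
  refine setIntegral_congr_fun measurableSet_Ioi fun u _ => ?_
  simp only [hG]
  obtain ⟨m, rfl⟩ : ∃ m : ℕ, n = m + 1 := ⟨n - 1, by omega⟩
  simp only [Nat.add_sub_cancel, div_pow, pow_succ]
  field_simp

end Iota

/-! ### The Euler factor of the `p`-stabilisation -/

section PStabilisation

variable {N : ℕ} [NeZero N] {p : ℕ} [Fact p.Prime]

/-- Integrability of the Mellin integrand `t^{n-1} f(it)` of a cusp form on `Γ₀(L)` of weight `k ≥ 2`
(from `integrableOn_mellin`, stated there in weight `m + 2`). [folklore] -/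
theorem integrableOn_completedLValue_integrand {L : ℕ} [NeZero L] {k : ℤ} (hk : 2 ≤ k)
    (f : CuspForm (Gamma0 L) k) (n : ℕ) :
    IntegrableOn (fun t : ℝ ↦ ((t : ℂ) ^ (n - 1)) * f (ofComplex ((t : ℂ) * Complex.I))) (Ioi 0) := by
  obtain ⟨m, rfl⟩ : ∃ m : ℕ, k = (m : ℤ) + 2 := ⟨(k - 2).toNat, by omega⟩
  exact integrableOn_mellin f (n - 1)

/-- **`Λ(ι_1 f − c • ι_p f, n) = (1 − c p^{−n}) Λ(f, n)`** for `f ∈ S_k(Γ₀(N))`, `k ≥ 2`, `0 < n`, and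
any `c ∈ ℂ` (the shape `F = ι_1 f − (a_p − u) • ι_p f` of the tree's `p`-stabilisation
`exists_ordinary_pStabilised_of_isNewform0`). [folklore] -/
theorem completedLValue_pStabilisation {k : ℤ} (hk : 2 ≤ k) (f : CuspForm (Gamma0 N) k) (c : ℂ)
    (h1 : N * 1 ∣ N * p) (hp : N * p ∣ N * p) {n : ℕ} (hn : 0 < n) :
    completedLValue (iota N (N * p) 1 k h1 f - c • iota N (N * p) p k hp f) n =
      (1 - c * ((p : ℂ) ^ n)⁻¹) * completedLValue f n := by
  haveI : NeZero p := ⟨(Fact.out : p.Prime).ne_zero⟩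
  haveI : NeZero (N * p) := ⟨mul_ne_zero (NeZero.ne N) (NeZero.ne p)⟩
  rw [completedLValue_sub _ _ n (integrableOn_completedLValue_integrand hk _ n)
      (integrableOn_completedLValue_integrand hk _ n),
    completedLValue_smul, completedLValue_iota h1 f hn, completedLValue_iota hp f hn]
  push_cast
  ring

/-- **The Euler factor of the `p`-stabilisation** (item (iii) of the docstring of
`greenbergStevens_kitagawa_twoVariable_interpolation`; Delbourgo 2008, Thm. 2.2 / Thm. 4.11): if
`u ≠ 0` is a root of the Hecke polynomial `X² − a_p X + p^{k−1}` and `F = ι_1 f − (a_p − u) • ι_p f`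
(so `U_p F = u F`, `exists_ordinary_pStabilised_of_isNewform0`), then for `0 < n`
`Λ(F, n) = (1 − p^{k−1−n}/u) Λ(f, n)` — i.e. `L(g^{(α)}, s) = (1 − β p^{−s}) L(g, s)`,
`β = p^{k−1}/α`. [cite: Delbourgo2008, Thm. 2.2 (PDF p. 41) and Thm. 4.11 (p. 99)] -/
theorem completedLValue_pStabilisation_unitRoot {k : ℤ} (hk : 2 ≤ k) (f : CuspForm (Gamma0 N) k)
    {ap u : ℂ} (hu : u ^ 2 - ap * u + (p : ℂ) ^ (k - 1) = 0) (hu0 : u ≠ 0)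
    (h1 : N * 1 ∣ N * p) (hp : N * p ∣ N * p) {n : ℕ} (hn : 0 < n) :
    completedLValue (iota N (N * p) 1 k h1 f - (ap - u) • iota N (N * p) p k hp f) n =
      (1 - (p : ℂ) ^ (k - 1 - n) / u) * completedLValue f n := by
  rw [completedLValue_pStabilisation hk f (ap - u) h1 hp hn]
  congr 1
  have hp0 : (p : ℂ) ≠ 0 := by exact_mod_cast (Fact.out : p.Prime).ne_zero
  have hβ : ap - u = (p : ℂ) ^ (k - 1) / u := by
    rw [eq_div_iff hu0]
    linear_combination -hu
  have hz : (p : ℂ) ^ (k - 1 - (n : ℤ)) = (p : ℂ) ^ (k - 1) * ((p : ℂ) ^ n)⁻¹ := by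
    rw [zpow_sub₀ hp0, zpow_natCast, div_eq_mul_inv]
  rw [hβ, hz]
  ring

end PStabilisation

/-! ### Embeddings of coefficient fields extend to field isomorphisms `ℚ̄_p ≃ ℂ` -/

section Embeddings

variable {p : ℕ} [Fact p.Prime]

/-- **Every embedding of a countable subfield of `ℂ` into `ℚ̄_p` is the restriction of a field
isomorphism `ℂ ≃ ℚ̄_p`** (Steinitz: `ℂ ≃ ℚ̄_p` abstractly, `Complex.nonempty_ringEquiv_padicAlgCl`, and
two embeddings of a countable field into `ℚ̄_p` are conjugate under `Aut(ℚ̄_p)`,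
`exists_ringEquiv_apply_eq`).  This is the device by which "fix embeddings `ι_∞ : ℚ̄ ⊂ ℂ`,
`ι_p : ℚ̄ → ℚ̄_p`" of the printed sources is matched with the arbitrary `ι : K_g →+* ℚ̄_p` of the
tree's statements. [folklore] -/
theorem exists_ringEquiv_symm_apply_eq_of_mk_le_aleph0 (K : IntermediateField ℚ ℂ) (hK : #K ≤ ℵ₀)
    (ι : K →+* PadicAlgCl p) : ∃ ι₀ : PadicAlgCl p ≃+* ℂ, ∀ x : K, ι₀.symm x = ι x := by
  obtain ⟨e⟩ := Complex.nonempty_ringEquiv_padicAlgCl p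
  have hΩ : ℵ₀ < #(PadicAlgCl p) := by
    rw [Cardinal.mk_padicAlgCl]; exact Cardinal.aleph0_lt_continuum
  obtain ⟨σ, hσ⟩ := Literature.FieldTheory.AlgClosed.exists_ringEquiv_apply_eq hΩ hK
    (e.toRingHom.comp (algebraMap K ℂ)) ι
  refine ⟨(e.trans σ).symm, fun x => ?_⟩
  rw [RingEquiv.symm_symm, RingEquiv.trans_apply]
  exact hσ x

/-- The coefficient field of a newform on `Γ₀(N)` is countable (it is a number field,
`IsNewform0.finiteDimensional_coeffField_holds`). [folklore] -/
theorem IsNewform0.mk_coeffField_le_aleph0 {N : ℕ} [NeZero N] {k : ℤ} {f : CuspForm (Gamma0 N) k}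
    (hf : IsNewform0 f) : #(coeffField f) ≤ ℵ₀ := by
  haveI : FiniteDimensional ℚ (coeffField f) := IsNewform0.finiteDimensional_coeffField_holds hf
  obtain ⟨n, φ, hφ⟩ := Module.Finite.exists_fin' ℚ (coeffField f)
  haveI : Countable (coeffField f) := hφ.countable
  exact Cardinal.mk_le_aleph0

/-- For a newform `f ∈ S_k(Γ₀(N))` every embedding `ι : K_f →+* ℚ̄_p` extends to a field isomorphism
`ι₀ : ℚ̄_p ≃ ℂ` (`ι₀⁻¹|_{K_f} = ι`). [folklore] -/
theorem IsNewform0.exists_ringEquiv_symm_apply_eq {N : ℕ} [NeZero N] {k : ℤ}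
    {f : CuspForm (Gamma0 N) k} (hf : IsNewform0 f) (ι : coeffField f →+* PadicAlgCl p) :
    ∃ ι₀ : PadicAlgCl p ≃+* ℂ, ∀ (x : ℂ) (hx : x ∈ coeffField f), ι ⟨x, hx⟩ = ι₀.symm x := by
  obtain ⟨ι₀, h⟩ := exists_ringEquiv_symm_apply_eq_of_mk_le_aleph0 (coeffField f)
    hf.mk_coeffField_le_aleph0 ι
  exact ⟨ι₀, fun x hx => (h ⟨x, hx⟩).symm⟩

end Embeddings

/-! ### The period bookkeeping of item (iii) of the docstring -/

section PeriodBookkeeping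

/-- `(2π)^n = iⁿ · (−2πi) · (2πi)^{n−1}` for odd `n`. [folklore] -/
theorem two_pi_pow_eq_of_odd {n : ℕ} (hn : Odd n) :
    (2 * Real.pi : ℂ) ^ n =
      Complex.I ^ n * (-(2 * Real.pi * Complex.I)) * (2 * Real.pi * Complex.I) ^ (n - 1) := by
  obtain ⟨m, rfl⟩ := hn
  have hI2m : Complex.I ^ (2 * m) = (-1) ^ m := by rw [pow_mul, I_sq]
  have hI : Complex.I ^ (2 * m + 1) = (-1) ^ m * Complex.I := by rw [pow_succ, hI2m]
  have h1 : ((-1 : ℂ) ^ m) * (-1) ^ m = 1 := by rw [← mul_pow, neg_one_mul, neg_neg, one_pow]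
  rw [Nat.add_sub_cancel]
  simp only [mul_pow, hI2m, hI]
  linear_combination ((2 : ℂ) ^ (2 * m + 1) * (Real.pi : ℂ) ^ (2 * m + 1) * (-1) ^ m * (-1) ^ m) * I_sq
    + (-(2 : ℂ) ^ (2 * m + 1) * (Real.pi : ℂ) ^ (2 * m + 1)) * h1

/-- **From Delbourgo's `j! L(·, j+1)/((2πi)^j Ω)` to the tree's `iⁿ Λ(·, n)/ω`** (`j = n − 1` even):
for odd `n` and non-zero `ω, Ω`,
`e · (2π)^n Λ / ((2πi)^{n−1} Ω) = e · (iⁿ Λ/ω) · (−2πi ω/Ω)` — the factor `r = −2πi ω/Ω` does not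
depend on `n`. [folklore] -/
theorem criticalValue_conversion_of_odd {n : ℕ} (hn : Odd n) (e L ω Ω : ℂ) (hω : ω ≠ 0)
    (hΩ : Ω ≠ 0) :
    e * ((2 * Real.pi : ℂ) ^ n * L) / ((2 * Real.pi * Complex.I) ^ (n - 1) * Ω) =
      e * (Complex.I ^ n * L / ω) * (-(2 * Real.pi * Complex.I) * ω / Ω) := by
  have hπI : (2 * Real.pi * Complex.I : ℂ) ^ (n - 1) ≠ 0 :=
    pow_ne_zero _ (mul_ne_zero (by exact_mod_cast (mul_pos two_pos Real.pi_pos).ne') I_ne_zero)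
  rw [two_pi_pow_eq_of_odd hn]
  field_simp

end PeriodBookkeeping

end Literature.NumberTheory.EllipticCurves.ModularForms

/-! ### The conditional assembly of the named fact -/

namespace Literature.NumberTheory.EllipticCurves

open Literature.NumberTheory.EllipticCurves.ModularForms

variable {p : ℕ} [Fact p.Prime]

/-- Descent of a proportionality constant from `ℚ̄_p` to `ℚ_p`: if two `ℚ_p`-valued sequences are
proportional in `ℚ̄_p` by a non-zero constant, they are proportional in `ℚ_p` by a non-zero
constant. [folklore] -/
theorem exists_ne_zero_forall_eq_mul_of_algebraMap (a b : ℕ → ℚ_[p]) (c : PadicAlgCl p) (hc : c ≠ 0)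
    (h : ∀ i, algebraMap ℚ_[p] (PadicAlgCl p) (a i) = c * algebraMap ℚ_[p] (PadicAlgCl p) (b i)) :
    ∃ c' : ℚ_[p], c' ≠ 0 ∧ ∀ i, a i = c' * b i := by
  have hinj := (algebraMap ℚ_[p] (PadicAlgCl p)).injective
  by_cases hb : ∃ i, b i ≠ 0
  · obtain ⟨i₀, hi₀⟩ := hb
    have hb0 : algebraMap ℚ_[p] (PadicAlgCl p) (b i₀) ≠ 0 := by
      rwa [map_ne_zero_iff _ hinj]
    have hc' : algebraMap ℚ_[p] (PadicAlgCl p) (a i₀ / b i₀) = c := by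
      rw [map_div₀, h i₀, mul_div_assoc, div_self hb0, mul_one]
    refine ⟨a i₀ / b i₀, fun h0 => hc ?_, fun i => hinj ?_⟩
    · rw [← hc', h0, map_zero]
    · rw [map_mul, hc', h i]
  · push Not at hb
    refine ⟨1, one_ne_zero, fun i => ?_⟩
    have := h i
    rw [hb i, map_zero, mul_zero, map_eq_zero_iff _ hinj] at this
    rw [this, hb i, mul_zero]

/-- **Conditional assembly of `greenbergStevens_kitagawa_twoVariable_interpolation`.**  The hypothesis
`hcore` is the `Λ`-adic core of the printed derivation, read in classical coordinates for the branch
through `f_E` (for `W`, `p` as in the fact and under its isolation hypothesis (Br)): a series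
`F ∈ ℤ_p⟦X, Y⟧` — the `ω⁰`-branch of Kitagawa's two-variable `p`-adic `L`-function of the branch
`𝕀 = 𝕋_𝔪 = Λ` (Hida 1986 control and freeness with (Br), Delbourgo 2008 Thm. 4.4 and p. 96; Kitagawa
1994 Thm. 1.1 = Delbourgo Cor. 4.8, Def. 4.9, Prop. 4.10, Thm. 4.11, p. 99) in the coordinates
`X = u^{−2}[u] − 1`, `1 + Y = [u]`, `u = 1 + p`, so that the arithmetic point `P_k` is `X = u^{k−2} − 1`
and the character `x ↦ x^j` of `ℤ_p^×` with `(p−1) ∣ j` is `Y = u^j − 1` — such that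
* (W2) [Delbourgo p. 100, first display, at `k = k₀ = 2`, `ψ = 𝟙`:
  `L^{GS}_p(𝐟, 𝟙, 2, s) = Per⁺_{𝕀,λ_{P_2}} × L_{p,α_p,Ω⁺}(𝐟_{P_2}, s)`, `𝐟_{P_2} = f_E^{(α)}`, together with
  Mazur–Tate–Teitelbaum 1986 §I.10–§I.13: the tree's `padicLFunction f α` IS `L_{p,α,Ω⁺_tree}(f)` in the
  variable `T = u^{s−1} − 1`, so the two normalisations differ by the non-zero constant
  `Per⁺_{P_2} · ι_p(Ω⁺_tree/Ω⁺)`] the `X = 0` row of `F` is a non-zero `ℚ̄_p`-multiple of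
  `padicLFunction f (unitRoot W p)` for the newform `f` of `W`;
* (I) [Delbourgo Thm. 4.11 for the primitive triple `(λ, 2, 𝟙)`, `M = 1`, at `P_k` (`k > 2`,
  `(p−1) ∣ (k−2)`, `𝕌_2 ⊇ ℤ_p` as `𝕀 = Λ`), `ψ = 𝟙`, `j = n − 1` with `(p−1) ∣ j`:
  `∫ x^j dμ_𝐟|_{P_k} = j! (1 − p^j/a_p(𝐟_{P_k})) · Per⁺_{𝕀,λ_{P_k}} · L(𝐟_{P_k}, j+1)/((2πi)^j Ω⁺_{𝐟_{P_k}})`,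
  where `j! L(𝐟_{P_k}, j+1) = (2π)^n Λ(𝐟_{P_k}, n)`; combined with the member identification of items
  (iv)–(v) of the fact's docstring (Hida: `𝕋_𝔪 = Λ` has ONE ordinary `𝔪`-eigensystem in weight `k`, so
  every `ι`-ordinary newform `g ∈ S_k(Γ₀(N))` congruent to `E` away from `Np` has
  `g^{(α)} = ι_1 g − (a_p(g) − u) ι_p g = 𝐟_{P_k}` read through the embeddings, with `u` the unit root,
  `|ι_p u − a_p(E)|_p < 1`)] for every field isomorphism `ι₀ : ℚ̄_p ≃ ℂ` and every such `g` (read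
  through `ι₀⁻¹`) there are `u ∈ ℂ` (`u² − a_p(g)u + p^{k−1} = 0`, `|ι₀⁻¹u|_p = 1`, `|ι₀⁻¹u − a_p(E)|_p < 1`),
  `Per ∈ ℚ̄_p^×`, `Ω ∈ ℂ^×` with
  `F(u^{k−2} − 1, u^{n−1} − 1) = Per · ι₀⁻¹((1 − p^{n−1}/u) (2π)^n Λ(g^{(α)}, n)/((2πi)^{n−1} Ω))`
  for all `0 < n < k` with `(p−1) ∣ (n−1)`.

GIVEN `hcore`, the fact follows by the classical glue PROVED in this file and in the tree: the Euler
factor of the `p`-stabilisation (`completedLValue_pStabilisation_unitRoot`), the extension of `ι` to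
`ι₀` (`IsNewform0.exists_ringEquiv_symm_apply_eq`), the rationality of the `+` critical values with one
period `ω⁺` (`IsNewform0.criticalValues_petersson_mem_coeffField`, Paşol–Popa Cor. 5.12), the period
bookkeeping `criticalValue_conversion_of_odd` (`r = −2πi ω⁺/Ω` independent of `n`, `Ω_fact = Per · ι₀⁻¹ r`),
multiplicativity of the norm, and the descent of the weight-`2` constant to `ℚ_p`
(`exists_ne_zero_forall_eq_mul_of_algebraMap`).  No `_holds` is claimed: `hcore` is NOT a fact of the
tree and is not vendored as one (D-0026); it records exactly what the `Λ`-adic theory has to deliver.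
[cite: Delbourgo2008, Thm 4.11, Def 4.12, Prop 4.10, p. 100] [cite: Kitagawa1994, Thm 1.1, Prop 5.12]
[cite: GreenbergStevens1993, §5] -/
theorem greenbergStevens_kitagawa_twoVariable_interpolation_of_core
    (hcore : ∀ (W : WeierstrassCurve ℚ) [W.IsElliptic] [W.IsGloballyMinimal]
      (_ : NeZero (W.conductorNorm ℤ)) (p : ℕ) [Fact p.Prime], 5 ≤ p → W.HasGoodReductionAtPrime p →
      ¬ (p : ℤ) ∣ W.frobeniusTrace p → W.HasSurjectiveModNGaloisRep p →
      (∀ (M : ℕ) (_ : NeZero M) (g : CuspForm (CongruenceSubgroup.Gamma0 M) 2)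
        (ι : coeffField g →+* PadicAlgCl p), M ∣ W.conductorNorm ℤ * p → IsNewform0 g →
        ‖ι ⟨(qExpansion 1 ⇑g).coeff p, coeff_mem_coeffField g p⟩‖ = 1 →
        (∀ ℓ : ℕ, ℓ.Prime → ¬ ℓ ∣ W.conductorNorm ℤ * p →
          ‖ι ⟨(qExpansion 1 ⇑g).coeff ℓ, coeff_mem_coeffField g ℓ⟩ -
            ((W.frobeniusTrace ℓ : ℤ) : PadicAlgCl p)‖ < 1) →
        M = W.conductorNorm ℤ ∧ ∀ n : ℕ, (qExpansion 1 ⇑g).coeff n = ((W.LFunction n : ℤ) : ℂ)) →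
      ∃ F : MvPowerSeries (Fin 2) ℚ_[p], IsPadicInt F ∧
        (∀ f : CuspForm (CongruenceSubgroup.Gamma0 (W.conductorNorm ℤ)) 2, IsNewformOf W f →
          ∃ c : PadicAlgCl p, c ≠ 0 ∧ ∀ i : ℕ,
            algebraMap ℚ_[p] (PadicAlgCl p) (MvPowerSeries.coeff (Finsupp.single 1 i) F) =
              c * algebraMap ℚ_[p] (PadicAlgCl p)
                (PowerSeries.coeff i (padicLFunction f (unitRoot W p : ℚ_[p])))) ∧
        (∀ (ι₀ : PadicAlgCl p ≃+* ℂ) (k : ℤ)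
          (g : CuspForm (CongruenceSubgroup.Gamma0 (W.conductorNorm ℤ)) k),
          2 < k → ((p : ℤ) - 1) ∣ (k - 2) → IsNewform0 g →
          ‖ι₀.symm ((qExpansion 1 ⇑g).coeff p)‖ = 1 →
          (∀ ℓ : ℕ, ℓ.Prime → ¬ ℓ ∣ W.conductorNorm ℤ * p →
            ‖ι₀.symm ((qExpansion 1 ⇑g).coeff ℓ) - ((W.frobeniusTrace ℓ : ℤ) : PadicAlgCl p)‖ < 1) →
          ∃ (u : ℂ) (Per : PadicAlgCl p) (Ω : ℂ),
            u ^ 2 - (qExpansion 1 ⇑g).coeff p * u + (p : ℂ) ^ (k - 1) = 0 ∧ ‖ι₀.symm u‖ = 1 ∧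
            ‖ι₀.symm u - ((W.frobeniusTrace p : ℤ) : PadicAlgCl p)‖ < 1 ∧ Per ≠ 0 ∧ Ω ≠ 0 ∧
            ∀ n : ℕ, 0 < n → (n : ℤ) < k → (p - 1) ∣ (n - 1) →
              algebraMap ℚ_[p] (PadicAlgCl p)
                  (padicEval₂ F ((1 + (p : ℚ_[p])) ^ (k - 2) - 1) ((1 + (p : ℚ_[p])) ^ (n - 1) - 1)) =
                Per * ι₀.symm ((1 - (p : ℂ) ^ (n - 1) / u) *
                  ((2 * Real.pi : ℂ) ^ n *
                    completedLValue
                      (iota (W.conductorNorm ℤ) (W.conductorNorm ℤ * p) 1 k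
                          (mul_dvd_mul_left _ (one_dvd _)) g -
                        ((qExpansion 1 ⇑g).coeff p - u) •
                          iota (W.conductorNorm ℤ) (W.conductorNorm ℤ * p) p k dvd_rfl g) n) /
                  ((2 * Real.pi * Complex.I) ^ (n - 1) * Ω)))) :
    greenbergStevens_kitagawa_twoVariable_interpolation := by
  intro W _ _ hN p _ hp5 hgood hord hsurj hBr
  haveI := hN
  obtain ⟨F, hint, hW2, hI⟩ := hcore W hN p hp5 hgood hord hsurj hBr
  refine ⟨F, hint, fun f hf => ?_, fun k g ι hk hpk hg hunit hcong => ?_⟩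
  · -- the weight-2 row: descend the constant to `ℚ_p`
    obtain ⟨c, hc, hci⟩ := hW2 f hf
    exact exists_ne_zero_forall_eq_mul_of_algebraMap _ _ c hc hci
  · -- the interpolation at `(x_k, y_n)`
    have hp : p.Prime := Fact.out
    -- read `ι` through a field isomorphism `ι₀ : ℚ̄_p ≃ ℂ`
    obtain ⟨ι₀, hι⟩ := hg.exists_ringEquiv_symm_apply_eq ι
    have hunit' : ‖ι₀.symm ((qExpansion 1 ⇑g).coeff p)‖ = 1 := by rw [← hι]; exact hunit
    have hcong' : ∀ ℓ : ℕ, ℓ.Prime → ¬ ℓ ∣ W.conductorNorm ℤ * p →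
        ‖ι₀.symm ((qExpansion 1 ⇑g).coeff ℓ) - ((W.frobeniusTrace ℓ : ℤ) : PadicAlgCl p)‖ < 1 :=
      fun ℓ hℓ hℓN => by rw [← hι]; exact hcong ℓ hℓ hℓN
    obtain ⟨u, Per, Ω, hu, hαu, hαE, hPer, hΩ, hval⟩ := hI ι₀ k g hk hpk hg hunit' hcong'
    have hu0 : u ≠ 0 := by
      rintro rfl
      rw [map_zero, norm_zero] at hαu
      exact zero_ne_one hαu
    -- the `+` period of Paşol–Popa (even weight `k ≥ 4`)
    have hp2 : p ≠ 2 := by omega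
    have hpodd : Odd p := hp.odd_of_ne_two hp2
    have hkeven : Even k := by
      obtain ⟨t, ht⟩ := hpk
      obtain ⟨s, hs⟩ := hpodd
      have : (p : ℤ) = 2 * s + 1 := by exact_mod_cast hs
      exact ⟨t * s + 1, by rw [this] at ht; linear_combination ht⟩
    have hk4 : 4 ≤ k := by obtain ⟨t, ht⟩ := hkeven; omega
    obtain ⟨ωp, ωm, hωp, -, hPP, -, -, -⟩ := hg.criticalValues_petersson_mem_coeffField hkeven hk4
    set r : ℂ := -(2 * Real.pi * Complex.I) * ωp / Ω with hr_def
    have h2πI : (2 * Real.pi * Complex.I : ℂ) ≠ 0 :=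
      mul_ne_zero (by exact_mod_cast (mul_pos two_pos Real.pi_pos).ne') Complex.I_ne_zero
    have hr : r ≠ 0 := div_ne_zero (mul_ne_zero (neg_ne_zero.mpr h2πI) hωp) hΩ
    have hιr : ι₀.symm r ≠ 0 := (map_ne_zero ι₀.symm).mpr hr
    refine ⟨Per * ι₀.symm r, ι₀.symm u, ωp, mul_ne_zero hPer hιr, hωp, hαu, ?_, hαE,
      fun n hn hnk hodd hpn => ?_⟩
    · -- `α = ι₀⁻¹ u` is a root of the `ι`-adic Hecke polynomial
      have h := congrArg ι₀.symm hu
      rw [map_add, map_sub, map_pow, map_mul, map_zero, map_zpow₀, map_natCast] at h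
      rw [show (k - 1 : ℤ) = (((k - 1).toNat : ℕ) : ℤ) from (Int.toNat_of_nonneg (by omega)).symm,
        zpow_natCast] at h
      rwa [hι]
    · -- the value at `(x_k, y_n)`
      have hnk' : (n : ℤ) < k := by omega
      have hpar : (n : ℤ).negOnePow = (k - 1).negOnePow := by
        rw [Int.negOnePow_odd _ hodd.natCast, Int.negOnePow_odd _ (hkeven.sub_odd odd_one)]
      have hmem : Complex.I ^ n * completedLValue g n / ωp ∈ coeffField g := (hPP n hn hnk').1 hpar
      refine ⟨hmem, ?_⟩
      have hv := hval n hn hnk' hpn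
      rw [completedLValue_pStabilisation_unitRoot (by omega : (2 : ℤ) ≤ k) g hu hu0
        (mul_dvd_mul_left _ (one_dvd _)) dvd_rfl hn] at hv
      -- regroup the two Euler factors and convert the period
      have hreg : (1 - (p : ℂ) ^ (n - 1) / u) *
          ((2 * Real.pi : ℂ) ^ n * ((1 - (p : ℂ) ^ (k - 1 - n) / u) * completedLValue g n)) /
            ((2 * Real.pi * Complex.I) ^ (n - 1) * Ω) =
          (1 - (p : ℂ) ^ (n - 1) / u) * (1 - (p : ℂ) ^ (k - 1 - n) / u) *
            (Complex.I ^ n * completedLValue g n / ωp) * r := by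
        rw [hr_def, ← criticalValue_conversion_of_odd hodd _ _ _ _ hωp hΩ]
        ring
      rw [hreg, map_mul, map_mul, ← hι _ hmem] at hv
      -- the Euler factors through `ι₀⁻¹`
      have he : ι₀.symm ((1 - (p : ℂ) ^ (n - 1) / u) * (1 - (p : ℂ) ^ (k - 1 - n) / u)) =
          (1 - (p : PadicAlgCl p) ^ (n - 1) / ι₀.symm u) *
            (1 - (p : PadicAlgCl p) ^ ((k - 1).toNat - n) / ι₀.symm u) := by
        have hexp : (k - 1 - (n : ℤ)) = (((k - 1).toNat - n : ℕ) : ℤ) := by omega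
        rw [hexp, zpow_natCast]
        simp only [map_mul, map_sub, map_one, map_div₀, map_pow, map_natCast]
      rw [he] at hv
      -- take norms
      rw [← norm_algebraMap' (PadicAlgCl p), hv]
      simp only [norm_mul]
      ring

/-! ### Reduction of the `Λ`-adic core to HIDA (the family) and KITAGAWA (its `L`-function)

The hypothesis `hcore` of `greenbergStevens_kitagawa_twoVariable_interpolation_of_core` is the
conjunction of two published theorems read in `q`-expansion coordinates.  We separate them.

**The interface: the `Λ`-adic `q`-expansion family through `f_E^{(α)}`.**  With `Λ = ℤ_p⟦X⟧`
(`X = u^{−2}[u] − 1`, `u = 1 + p`, so that the arithmetic point `P_k` is `X = x_k := u^{k−2} − 1`),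
an ordinary `Λ`-adic cusp form of tame level `N` is a `q`-expansion `Σ A_n qⁿ ∈ Λ⟦q⟧` whose
specialisations `Σ A_n(x_k) qⁿ` at the arithmetic points are the `q`-expansions of classical
ordinary eigenforms (Delbourgo 2008, §4.2, pp. 89–91: `𝕊^{ord}_𝕀` is the `𝒪`-dual of
`h^{ord}(Np^∞; 𝒪)` [Hi2, Wi2], `λ(T_n) = a_n(𝐟)`, `a_n(𝐟_P) = λ_P(T_n)`; Wiles 1988, §1.2).  In the
tree's vocabulary (no `Λ`-adic objects) such a family is a sequence `A : ℕ → ℚ_p⟦X⟧` of INTEGRAL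
series (`IsPadicInt`), and "`(g, u)` is the weight-`k` member, read through the field isomorphism
`ι₀ : ℚ̄_p ≃ ℂ`" is the coefficientwise identity
`ι₀⁻¹(a_n(g^{(u)})) = A_n(x_k)`, `g^{(u)} = ι_1 g − (a_p(g) − u) ι_p g` the `p`-stabilisation of the
newform `g ∈ S_k(Γ₀(N))` at the root `u` of `X² − a_p(g)X + p^{k−1}` (`padicEval`, the tree's
evaluation of integral series on the open unit disc).  The family THROUGH `f_E^{(α_E)}` has the
weight-`2` specialisation `A_n(0) = a_n(E) − (a_p(E) − α_E)𝟙_{p∣n} a_{n/p}(E)` (`a_n(E) =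
W.LFunction n ∈ ℤ`, `α_E = unitRoot W p`), and classical members `g_k^{(u_k)}`, `g_k ∈ S_k(Γ₀(N))`
a newform, at every `k > 2`, `k ≡ 2 (mod p−1)`.

* (H) **Hida** [Hida 1986 (Invent. 85) with Hida 1986 (Ann. ÉNS 19): `h^{ord}` is free of finite
  rank over `Λ` and controlled, `p ≥ 5` — Delbourgo Thm. 4.4, Hida EMI Thm. 4.1.24/4.1.29 and
  Cor. 4.1.30 (the `p` removed from the level for `k ≥ 3`); Emerton–Pollack–Weston 2005,
  Thm. 2.1.2, Thm. 2.2.2; with the isolation hypothesis (Br): "if there is a unique `p`-stabilised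
  ordinary newform of tame conductor `N` then `𝕀 = Λ^{wt}`", Delbourgo p. 96] — items (i), (iv), (v)
  of the fact's docstring: under (Br) the local component `𝕋_𝔪` through `f_E^{(α_E)}` IS `Λ`, so
  `T_n ↦ A_n ∈ Λ` is a `Λ`-adic `q`-expansion family through `f_E^{(α_E)}` with a classical
  `p`-stabilised-newform member in every weight `k ≡ 2 (mod p−1)`, and EVERY `ι₀⁻¹`-ordinary newform
  `g ∈ S_k(Γ₀(N))`, `k > 2`, `k ≡ 2 (mod p−1)`, congruent to `E` away from `Np` is a member (one
  ordinary `𝔪`-eigensystem per weight).  This is the hypothesis `hHida` below.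
* (K) **Kitagawa** [Kitagawa 1994, Thm. 1.1 with Lemma 5.11 (`𝕀 = Λ` factorial ⇒ `MS^{ord}(𝕀)^±[λ]`
  free of rank one) and Prop. 5.12 (the `p`-adic periods generate NON-ZERO ideals); Delbourgo
  Cor. 4.8, Def. 4.9, Prop. 4.10, Thm. 4.11 [GS, Ki], Def. 4.12 and the first display of p. 100;
  Greenberg–Stevens 1993, §5; at `k = 2` Mazur–Tate–Teitelbaum 1986, §I.10–§I.14 for the comparison
  with the tree's `padicLFunction`] — items (ii), (iii), (vi): for such a family there is
  `F ∈ ℤ_p⟦X, Y⟧` whose `X = 0` row is a non-zero `ℚ̄_p`-multiple of `padicLFunction f α_E` and whose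
  values `F(x_k, u^{n−1} − 1)` at every member `(g, u)` of weight `k > 2` are
  `Per · ι₀⁻¹((1 − p^{n−1}/u)(2π)ⁿ Λ(g^{(u)}, n)/((2πi)^{n−1} Ω))`, `0 < n < k`, `(p−1) ∣ (n−1)`, with
  `Per ∈ ℚ̄_p^×`, `Ω ∈ ℂ^×` depending on the member only (Thm. 4.11 at `P_k`, `ψ = 𝟙`, `j = n − 1`).
  This is the hypothesis `hKitagawa` below; it carries no isolation / Galois hypothesis.

`core_of_hidaFamily_of_kitagawa : hHida → hKitagawa → hcore` is then PROVED: the only glue is the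
unit-root congruence `|ι₀⁻¹u − a_p(E)|_p < 1` of item (iv), which here needs no Galois input —
`ι₀⁻¹u = A_p(x_k)` (`a_p(g^{(u)}) = u`, `qExpansion_coeff_pStabilisation_self`), `A_p` is an INTEGRAL
series with `A_p(0) = α_E`, so `|A_p(x_k) − α_E|_p ≤ |x_k|_p < 1`
(`norm_padicEval_sub_constantCoeff_lt_one`), and `|α_E − a_p(E)|_p = |p/α_E|_p < 1` — together with
`|ι₀⁻¹u|_p = 1` by the same route.  Composed with `…_of_core` this gives
`greenbergStevens_kitagawa_twoVariable_interpolation_of_hidaFamily_of_kitagawa`.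
Neither hypothesis is a fact of the tree; nothing is vendored (D-0026). -/

section Reduction

/-- For an integral series `f ∈ ℤ_p⟦X⟧` and `‖t‖_p < 1`: `‖f(t) − f(0)‖_p < 1` (indeed `≤ ‖t‖_p`).
[folklore] -/
theorem norm_padicEval_sub_constantCoeff_lt_one {f : PowerSeries ℚ_[p]} (hf : IsPadicInt f) {t : ℚ_[p]}
    (ht : ‖t‖ < 1) : ‖padicEval f t - PowerSeries.constantCoeff f‖ < 1 := by
  have hc : ‖PowerSeries.constantCoeff f‖ ≤ 1 := by
    simpa [PowerSeries.coeff_zero_eq_constantCoeff] using isPadicInt_iff_coeff.mp hf 0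
  have hC : IsPadicInt (PowerSeries.C (PowerSeries.constantCoeff f) : PowerSeries ℚ_[p]) :=
    IsPadicInt.C (σ := Unit) hc
  have h := norm_padicEval_lt_one (hf.sub hC) (by simp) ht
  rwa [padicEval_sub hf hC ht, padicEval_C] at h

/-- The `p`-th Fourier coefficient of the `p`-stabilisation `g^{(u)} = ι_1 g − (a_p(g) − u) ι_p g` of a
normalised `g ∈ S_k(Γ₀(N))` is `u` (`a_p(ι_1 g) = a_p(g)`, `a_p(ι_p g) = a_1(g) = 1`). [folklore] -/
theorem qExpansion_coeff_pStabilisation_self {N : ℕ} [NeZero N] {k : ℤ}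
    (g : CuspForm (CongruenceSubgroup.Gamma0 N) k) (hg1 : IsNormalized g) (u : ℂ) :
    (qExpansion 1 ⇑(iota N (N * p) 1 k (mul_dvd_mul_left _ (one_dvd _)) g -
        ((qExpansion 1 ⇑g).coeff p - u) • iota N (N * p) p k dvd_rfl g)).coeff p = u := by
  have hp : p.Prime := Fact.out
  rw [qExpansion_coeff_sub_smul, qExpansion_coeff_iota, qExpansion_coeff_iota, if_pos (one_dvd _),
    if_pos dvd_rfl, Nat.div_one, Nat.div_self hp.pos, show (qExpansion 1 ⇑g).coeff 1 = 1 from hg1]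
  ring

/-- **`hcore` from Hida's family and Kitagawa's theorem (q-expansion form).**  See the section
docstring: `hHida` is Hida 1986 control/freeness with (Br) (`𝕋_𝔪 = Λ`; Delbourgo 2008 Thm. 4.4 and
p. 96; Emerton–Pollack–Weston 2005 Thms. 2.1.2, 2.2.2; Hida EMI Cor. 4.1.30) — a `Λ`-adic
`q`-expansion family `A` through `f_E^{(α_E)}` with classical `p`-stabilised-newform members in every
weight `k ≡ 2 (mod p−1)` of which every congruent `ι₀⁻¹`-ordinary newform is a member; `hKitagawa` is
Kitagawa 1994 Thm. 1.1 (with Lemma 5.11, Prop. 5.12; Delbourgo Thm. 4.11, Def. 4.12, p. 100;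
Greenberg–Stevens 1993 §5; MTT 1986 §I.10–I.14 at `k = 2`) for such a family.  The glue proved here is
the unit-root congruence of item (iv) from the analyticity of `A_p` (`A_p(0) = α_E`,
`|A_p(x_k) − A_p(0)|_p < 1`, `|α_E − a_p(E)|_p = p^{−1}`) and `a_p(g^{(u)}) = u`.
[cite: Hida1986] [cite: EmertonPollackWeston2005, Thm. 2.1.2, Thm. 2.2.2] [cite: Delbourgo2008, Thm 4.4, §4.2 pp. 89–91, p. 96, Thm 4.11, Def 4.12, Prop 4.10, p. 100]
[cite: Kitagawa1994, Thm 1.1, Lemma 5.11, Prop 5.12] [cite: GreenbergStevens1993, §5] -/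
theorem core_of_hidaFamily_of_kitagawa
    (hHida : ∀ (W : WeierstrassCurve ℚ) [W.IsElliptic] [W.IsGloballyMinimal]
      (_ : NeZero (W.conductorNorm ℤ)) (p : ℕ) [Fact p.Prime], 5 ≤ p → W.HasGoodReductionAtPrime p →
      ¬ (p : ℤ) ∣ W.frobeniusTrace p → W.HasSurjectiveModNGaloisRep p →
      (∀ (M : ℕ) (_ : NeZero M) (g : CuspForm (CongruenceSubgroup.Gamma0 M) 2)
        (ι : coeffField g →+* PadicAlgCl p), M ∣ W.conductorNorm ℤ * p → IsNewform0 g →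
        ‖ι ⟨(qExpansion 1 ⇑g).coeff p, coeff_mem_coeffField g p⟩‖ = 1 →
        (∀ ℓ : ℕ, ℓ.Prime → ¬ ℓ ∣ W.conductorNorm ℤ * p →
          ‖ι ⟨(qExpansion 1 ⇑g).coeff ℓ, coeff_mem_coeffField g ℓ⟩ -
            ((W.frobeniusTrace ℓ : ℤ) : PadicAlgCl p)‖ < 1) →
        M = W.conductorNorm ℤ ∧ ∀ n : ℕ, (qExpansion 1 ⇑g).coeff n = ((W.LFunction n : ℤ) : ℂ)) →
      ∃ A : ℕ → PowerSeries ℚ_[p],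
        ((∀ n, IsPadicInt (A n)) ∧
          (∀ n : ℕ, PowerSeries.constantCoeff (A n) =
            ((W.LFunction n : ℤ) : ℚ_[p]) -
              (((W.LFunction p : ℤ) : ℚ_[p]) - (unitRoot W p : ℚ_[p])) *
                (if p ∣ n then ((W.LFunction (n / p) : ℤ) : ℚ_[p]) else 0)) ∧
          (∀ k : ℤ, 2 < k → ((p : ℤ) - 1) ∣ (k - 2) →
            ∃ (g : CuspForm (CongruenceSubgroup.Gamma0 (W.conductorNorm ℤ)) k)
              (ι₀ : PadicAlgCl p ≃+* ℂ) (u : ℂ), IsNewform0 g ∧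
              u ^ 2 - (qExpansion 1 ⇑g).coeff p * u + (p : ℂ) ^ (k - 1) = 0 ∧
              ∀ n : ℕ, ι₀.symm ((qExpansion 1 ⇑(iota (W.conductorNorm ℤ) (W.conductorNorm ℤ * p) 1 k
                  (mul_dvd_mul_left _ (one_dvd _)) g - ((qExpansion 1 ⇑g).coeff p - u) •
                  iota (W.conductorNorm ℤ) (W.conductorNorm ℤ * p) p k dvd_rfl g)).coeff n) =
                algebraMap ℚ_[p] (PadicAlgCl p) (padicEval (A n) ((1 + (p : ℚ_[p])) ^ (k - 2) - 1)))) ∧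
        (∀ (ι₀ : PadicAlgCl p ≃+* ℂ) (k : ℤ)
          (g : CuspForm (CongruenceSubgroup.Gamma0 (W.conductorNorm ℤ)) k),
          2 < k → ((p : ℤ) - 1) ∣ (k - 2) → IsNewform0 g →
          ‖ι₀.symm ((qExpansion 1 ⇑g).coeff p)‖ = 1 →
          (∀ ℓ : ℕ, ℓ.Prime → ¬ ℓ ∣ W.conductorNorm ℤ * p →
            ‖ι₀.symm ((qExpansion 1 ⇑g).coeff ℓ) - ((W.frobeniusTrace ℓ : ℤ) : PadicAlgCl p)‖ < 1) →
          ∃ u : ℂ, u ^ 2 - (qExpansion 1 ⇑g).coeff p * u + (p : ℂ) ^ (k - 1) = 0 ∧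
            ∀ n : ℕ, ι₀.symm ((qExpansion 1 ⇑(iota (W.conductorNorm ℤ) (W.conductorNorm ℤ * p) 1 k
                (mul_dvd_mul_left _ (one_dvd _)) g - ((qExpansion 1 ⇑g).coeff p - u) •
                iota (W.conductorNorm ℤ) (W.conductorNorm ℤ * p) p k dvd_rfl g)).coeff n) =
              algebraMap ℚ_[p] (PadicAlgCl p) (padicEval (A n) ((1 + (p : ℚ_[p])) ^ (k - 2) - 1))))
    (hKitagawa : ∀ (W : WeierstrassCurve ℚ) [W.IsElliptic] [W.IsGloballyMinimal]
      (_ : NeZero (W.conductorNorm ℤ)) (p : ℕ) [Fact p.Prime], 5 ≤ p → W.HasGoodReductionAtPrime p →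
      ¬ (p : ℤ) ∣ W.frobeniusTrace p → ∀ A : ℕ → PowerSeries ℚ_[p],
      ((∀ n, IsPadicInt (A n)) ∧
          (∀ n : ℕ, PowerSeries.constantCoeff (A n) =
            ((W.LFunction n : ℤ) : ℚ_[p]) -
              (((W.LFunction p : ℤ) : ℚ_[p]) - (unitRoot W p : ℚ_[p])) *
                (if p ∣ n then ((W.LFunction (n / p) : ℤ) : ℚ_[p]) else 0)) ∧
          (∀ k : ℤ, 2 < k → ((p : ℤ) - 1) ∣ (k - 2) →
            ∃ (g : CuspForm (CongruenceSubgroup.Gamma0 (W.conductorNorm ℤ)) k)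
              (ι₀ : PadicAlgCl p ≃+* ℂ) (u : ℂ), IsNewform0 g ∧
              u ^ 2 - (qExpansion 1 ⇑g).coeff p * u + (p : ℂ) ^ (k - 1) = 0 ∧
              ∀ n : ℕ, ι₀.symm ((qExpansion 1 ⇑(iota (W.conductorNorm ℤ) (W.conductorNorm ℤ * p) 1 k
                  (mul_dvd_mul_left _ (one_dvd _)) g - ((qExpansion 1 ⇑g).coeff p - u) •
                  iota (W.conductorNorm ℤ) (W.conductorNorm ℤ * p) p k dvd_rfl g)).coeff n) =
                algebraMap ℚ_[p] (PadicAlgCl p) (padicEval (A n) ((1 + (p : ℚ_[p])) ^ (k - 2) - 1)))) →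
      ∃ F : MvPowerSeries (Fin 2) ℚ_[p], IsPadicInt F ∧
        (∀ f : CuspForm (CongruenceSubgroup.Gamma0 (W.conductorNorm ℤ)) 2, IsNewformOf W f →
          ∃ c : PadicAlgCl p, c ≠ 0 ∧ ∀ i : ℕ,
            algebraMap ℚ_[p] (PadicAlgCl p) (MvPowerSeries.coeff (Finsupp.single 1 i) F) =
              c * algebraMap ℚ_[p] (PadicAlgCl p)
                (PowerSeries.coeff i (padicLFunction f (unitRoot W p : ℚ_[p])))) ∧
        (∀ (ι₀ : PadicAlgCl p ≃+* ℂ) (k : ℤ)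
          (g : CuspForm (CongruenceSubgroup.Gamma0 (W.conductorNorm ℤ)) k) (u : ℂ),
          2 < k → ((p : ℤ) - 1) ∣ (k - 2) → IsNewform0 g →
          u ^ 2 - (qExpansion 1 ⇑g).coeff p * u + (p : ℂ) ^ (k - 1) = 0 →
          (∀ n : ℕ, ι₀.symm ((qExpansion 1 ⇑(iota (W.conductorNorm ℤ) (W.conductorNorm ℤ * p) 1 k
              (mul_dvd_mul_left _ (one_dvd _)) g - ((qExpansion 1 ⇑g).coeff p - u) •
              iota (W.conductorNorm ℤ) (W.conductorNorm ℤ * p) p k dvd_rfl g)).coeff n) =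
            algebraMap ℚ_[p] (PadicAlgCl p) (padicEval (A n) ((1 + (p : ℚ_[p])) ^ (k - 2) - 1))) →
          ∃ (Per : PadicAlgCl p) (Ω : ℂ), Per ≠ 0 ∧ Ω ≠ 0 ∧
            ∀ n : ℕ, 0 < n → (n : ℤ) < k → (p - 1) ∣ (n - 1) →
              algebraMap ℚ_[p] (PadicAlgCl p)
                  (padicEval₂ F ((1 + (p : ℚ_[p])) ^ (k - 2) - 1) ((1 + (p : ℚ_[p])) ^ (n - 1) - 1)) =
                Per * ι₀.symm ((1 - (p : ℂ) ^ (n - 1) / u) *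
                  ((2 * Real.pi : ℂ) ^ n *
                    completedLValue
                      (iota (W.conductorNorm ℤ) (W.conductorNorm ℤ * p) 1 k
                          (mul_dvd_mul_left _ (one_dvd _)) g -
                        ((qExpansion 1 ⇑g).coeff p - u) •
                          iota (W.conductorNorm ℤ) (W.conductorNorm ℤ * p) p k dvd_rfl g) n) /
                  ((2 * Real.pi * Complex.I) ^ (n - 1) * Ω)))) :
    ∀ (W : WeierstrassCurve ℚ) [W.IsElliptic] [W.IsGloballyMinimal]
      (_ : NeZero (W.conductorNorm ℤ)) (p : ℕ) [Fact p.Prime], 5 ≤ p → W.HasGoodReductionAtPrime p →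
      ¬ (p : ℤ) ∣ W.frobeniusTrace p → W.HasSurjectiveModNGaloisRep p →
      (∀ (M : ℕ) (_ : NeZero M) (g : CuspForm (CongruenceSubgroup.Gamma0 M) 2)
        (ι : coeffField g →+* PadicAlgCl p), M ∣ W.conductorNorm ℤ * p → IsNewform0 g →
        ‖ι ⟨(qExpansion 1 ⇑g).coeff p, coeff_mem_coeffField g p⟩‖ = 1 →
        (∀ ℓ : ℕ, ℓ.Prime → ¬ ℓ ∣ W.conductorNorm ℤ * p →
          ‖ι ⟨(qExpansion 1 ⇑g).coeff ℓ, coeff_mem_coeffField g ℓ⟩ -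
            ((W.frobeniusTrace ℓ : ℤ) : PadicAlgCl p)‖ < 1) →
        M = W.conductorNorm ℤ ∧ ∀ n : ℕ, (qExpansion 1 ⇑g).coeff n = ((W.LFunction n : ℤ) : ℂ)) →
      ∃ F : MvPowerSeries (Fin 2) ℚ_[p], IsPadicInt F ∧
        (∀ f : CuspForm (CongruenceSubgroup.Gamma0 (W.conductorNorm ℤ)) 2, IsNewformOf W f →
          ∃ c : PadicAlgCl p, c ≠ 0 ∧ ∀ i : ℕ,
            algebraMap ℚ_[p] (PadicAlgCl p) (MvPowerSeries.coeff (Finsupp.single 1 i) F) =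
              c * algebraMap ℚ_[p] (PadicAlgCl p)
                (PowerSeries.coeff i (padicLFunction f (unitRoot W p : ℚ_[p])))) ∧
        (∀ (ι₀ : PadicAlgCl p ≃+* ℂ) (k : ℤ)
          (g : CuspForm (CongruenceSubgroup.Gamma0 (W.conductorNorm ℤ)) k),
          2 < k → ((p : ℤ) - 1) ∣ (k - 2) → IsNewform0 g →
          ‖ι₀.symm ((qExpansion 1 ⇑g).coeff p)‖ = 1 →
          (∀ ℓ : ℕ, ℓ.Prime → ¬ ℓ ∣ W.conductorNorm ℤ * p →
            ‖ι₀.symm ((qExpansion 1 ⇑g).coeff ℓ) - ((W.frobeniusTrace ℓ : ℤ) : PadicAlgCl p)‖ < 1) →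
          ∃ (u : ℂ) (Per : PadicAlgCl p) (Ω : ℂ),
            u ^ 2 - (qExpansion 1 ⇑g).coeff p * u + (p : ℂ) ^ (k - 1) = 0 ∧ ‖ι₀.symm u‖ = 1 ∧
            ‖ι₀.symm u - ((W.frobeniusTrace p : ℤ) : PadicAlgCl p)‖ < 1 ∧ Per ≠ 0 ∧ Ω ≠ 0 ∧
            ∀ n : ℕ, 0 < n → (n : ℤ) < k → (p - 1) ∣ (n - 1) →
              algebraMap ℚ_[p] (PadicAlgCl p)
                  (padicEval₂ F ((1 + (p : ℚ_[p])) ^ (k - 2) - 1) ((1 + (p : ℚ_[p])) ^ (n - 1) - 1)) =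
                Per * ι₀.symm ((1 - (p : ℂ) ^ (n - 1) / u) *
                  ((2 * Real.pi : ℂ) ^ n *
                    completedLValue
                      (iota (W.conductorNorm ℤ) (W.conductorNorm ℤ * p) 1 k
                          (mul_dvd_mul_left _ (one_dvd _)) g -
                        ((qExpansion 1 ⇑g).coeff p - u) •
                          iota (W.conductorNorm ℤ) (W.conductorNorm ℤ * p) p k dvd_rfl g) n) /
                  ((2 * Real.pi * Complex.I) ^ (n - 1) * Ω))) := by
  intro W _ _ hN p _ hp5 hgood hord hsurj hBr
  haveI := hN
  obtain ⟨A, hFam, hU⟩ := hHida W hN p hp5 hgood hord hsurj hBr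
  obtain ⟨F, hint, hW2, hKI⟩ := hKitagawa W hN p hp5 hgood hord A hFam
  refine ⟨F, hint, hW2, fun ι₀ k g hk hpk hg hunit hcong => ?_⟩
  obtain ⟨u, hu, hmem⟩ := hU ι₀ k g hk hpk hg hunit hcong
  obtain ⟨Per, Ω, hPer, hΩ, hval⟩ := hKI ι₀ k g u hk hpk hg hu hmem
  have hp : p.Prime := Fact.out
  -- the arithmetic point `x_k` lies in the open unit disc
  set xk : ℚ_[p] := (1 + (p : ℚ_[p])) ^ (k - 2) - 1 with hxk_def
  have hxk : ‖xk‖ < 1 := by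
    obtain ⟨m, hm⟩ : ∃ m : ℕ, (k - 2 : ℤ) = m := ⟨(k - 2).toNat, (Int.toNat_of_nonneg (by omega)).symm⟩
    rw [hxk_def, hm, zpow_natCast]
    -- `(1 + p)^m − 1 = p · c` with `c ∈ ℤ_p`
    have hdvd : ((1 + (p : ℤ_[p])) - 1) ∣ (1 + (p : ℤ_[p])) ^ m - 1 ^ m := sub_dvd_pow_sub_pow _ _ m
    rw [one_pow, add_sub_cancel_left] at hdvd
    obtain ⟨c, hc⟩ := hdvd
    have h : (1 + (p : ℚ_[p])) ^ m - 1 = (((1 + (p : ℤ_[p])) ^ m - 1 : ℤ_[p]) : ℚ_[p]) := by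
      push_cast; ring
    rw [h, PadicInt.padic_norm_e_of_padicInt, hc, norm_mul, PadicInt.norm_p]
    have hp1 : (1 : ℝ) < p := by exact_mod_cast hp.one_lt
    calc (p : ℝ)⁻¹ * ‖c‖ ≤ (p : ℝ)⁻¹ * 1 := by gcongr; exact PadicInt.norm_le_one c
      _ < 1 := by rw [mul_one]; exact inv_lt_one_of_one_lt₀ hp1
  -- `ι₀⁻¹ u = A_p(x_k)`
  have key : ι₀.symm u = algebraMap ℚ_[p] (PadicAlgCl p) (padicEval (A p) xk) := by
    have h := hmem p
    rwa [qExpansion_coeff_pStabilisation_self g hg.2.2 u] at h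
  -- `A_p(0) = α_E`
  have hordW : IsOrdinaryAt W p := (isOrdinaryAt_iff W p).mpr ⟨hgood, hord⟩
  set α : ℚ_[p] := (unitRoot W p : ℚ_[p]) with hα_def
  have hA0 : PowerSeries.constantCoeff (A p) = α := by
    have h := hFam.2.1 p
    rw [if_pos dvd_rfl, Nat.div_self hp.pos, W.LFunction_apply_one] at h
    rw [h]; push_cast; ring
  -- `|A_p(x_k) − α_E| < 1`, `|α_E| = 1`, `|α_E − a_p(E)| < 1`
  have hdiff : ‖padicEval (A p) xk - α‖ < 1 := by
    rw [← hA0]; exact norm_padicEval_sub_constantCoeff_lt_one (hFam.1 p) hxk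
  have hαnorm : ‖α‖ = 1 := norm_unitRoot_holds W p hordW
  have hαeq : α ^ 2 - ((W.frobeniusTrace p : ℤ) : ℚ_[p]) * α + p = 0 := by
    have h := congrArg ((↑) : ℤ_[p] → ℚ_[p]) (unitRoot_spec_holds W p hordW).1
    push_cast at h
    exact h
  have hα0 : α ≠ 0 := norm_ne_zero_iff.mp (by rw [hαnorm]; exact one_ne_zero)
  have hαcong : ‖α - ((W.frobeniusTrace p : ℤ) : ℚ_[p])‖ < 1 := by
    have hmul : α * (α - ((W.frobeniusTrace p : ℤ) : ℚ_[p])) = -p := by linear_combination hαeq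
    have hn : ‖α‖ * ‖α - ((W.frobeniusTrace p : ℤ) : ℚ_[p])‖ = ‖(p : ℚ_[p])‖ := by
      rw [← norm_mul, hmul, norm_neg]
    rw [hαnorm, one_mul] at hn
    rw [hn]
    exact Padic.norm_p_lt_one
  have hAnorm : ‖padicEval (A p) xk‖ = 1 := by
    have h : padicEval (A p) xk = α + (padicEval (A p) xk - α) := by ring
    have hne : ‖α‖ ≠ ‖padicEval (A p) xk - α‖ := by rw [hαnorm]; exact hdiff.ne'
    rw [h, IsUltrametricDist.norm_add_eq_max_of_norm_ne_norm hne, hαnorm]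
    exact max_eq_left hdiff.le
  have hAcong : ‖padicEval (A p) xk - ((W.frobeniusTrace p : ℤ) : ℚ_[p])‖ < 1 := by
    have h : padicEval (A p) xk - ((W.frobeniusTrace p : ℤ) : ℚ_[p]) =
        (padicEval (A p) xk - α) + (α - ((W.frobeniusTrace p : ℤ) : ℚ_[p])) := by ring
    rw [h]
    exact (IsUltrametricDist.norm_add_le_max _ _).trans_lt (max_lt hdiff hαcong)
  refine ⟨u, Per, Ω, hu, ?_, ?_, hPer, hΩ, hval⟩
  · rw [key, norm_algebraMap', hAnorm]
  · rw [key, ← map_intCast (algebraMap ℚ_[p] (PadicAlgCl p)), ← map_sub, norm_algebraMap']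
    exact hAcong

/-- **`greenbergStevens_kitagawa_twoVariable_interpolation` from Hida's family and Kitagawa's theorem**
(q-expansion form): the composition of `core_of_hidaFamily_of_kitagawa` with
`greenbergStevens_kitagawa_twoVariable_interpolation_of_core`.  The two hypotheses are the two
published theorems behind the named fact — Hida 1986 (control and freeness of the ordinary
`Λ`-adic Hecke algebra of tame level `Γ₀(N)`, `p ≥ 5`, with the isolation hypothesis (Br):
`𝕋_𝔪 = Λ`) and Kitagawa 1994 Thm. 1.1 / Greenberg–Stevens 1993 §5 (the two-variable `p`-adic
`L`-function of that family, Delbourgo 2008 Thm. 4.11 and p. 100) — read in the tree's classical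
coordinates; everything else is proved.  Neither hypothesis is a fact of the tree (D-0026).
[cite: Hida1986] [cite: Kitagawa1994, Thm 1.1, Prop 5.12] [cite: Delbourgo2008, Thm 4.4, p. 96, Thm 4.11, p. 100]
[cite: GreenbergStevens1993, §5] -/
theorem greenbergStevens_kitagawa_twoVariable_interpolation_of_hidaFamily_of_kitagawa
    (hHida : ∀ (W : WeierstrassCurve ℚ) [W.IsElliptic] [W.IsGloballyMinimal]
      (_ : NeZero (W.conductorNorm ℤ)) (p : ℕ) [Fact p.Prime], 5 ≤ p → W.HasGoodReductionAtPrime p →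
      ¬ (p : ℤ) ∣ W.frobeniusTrace p → W.HasSurjectiveModNGaloisRep p →
      (∀ (M : ℕ) (_ : NeZero M) (g : CuspForm (CongruenceSubgroup.Gamma0 M) 2)
        (ι : coeffField g →+* PadicAlgCl p), M ∣ W.conductorNorm ℤ * p → IsNewform0 g →
        ‖ι ⟨(qExpansion 1 ⇑g).coeff p, coeff_mem_coeffField g p⟩‖ = 1 →
        (∀ ℓ : ℕ, ℓ.Prime → ¬ ℓ ∣ W.conductorNorm ℤ * p →
          ‖ι ⟨(qExpansion 1 ⇑g).coeff ℓ, coeff_mem_coeffField g ℓ⟩ -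
            ((W.frobeniusTrace ℓ : ℤ) : PadicAlgCl p)‖ < 1) →
        M = W.conductorNorm ℤ ∧ ∀ n : ℕ, (qExpansion 1 ⇑g).coeff n = ((W.LFunction n : ℤ) : ℂ)) →
      ∃ A : ℕ → PowerSeries ℚ_[p],
        ((∀ n, IsPadicInt (A n)) ∧
          (∀ n : ℕ, PowerSeries.constantCoeff (A n) =
            ((W.LFunction n : ℤ) : ℚ_[p]) -
              (((W.LFunction p : ℤ) : ℚ_[p]) - (unitRoot W p : ℚ_[p])) *
                (if p ∣ n then ((W.LFunction (n / p) : ℤ) : ℚ_[p]) else 0)) ∧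
          (∀ k : ℤ, 2 < k → ((p : ℤ) - 1) ∣ (k - 2) →
            ∃ (g : CuspForm (CongruenceSubgroup.Gamma0 (W.conductorNorm ℤ)) k)
              (ι₀ : PadicAlgCl p ≃+* ℂ) (u : ℂ), IsNewform0 g ∧
              u ^ 2 - (qExpansion 1 ⇑g).coeff p * u + (p : ℂ) ^ (k - 1) = 0 ∧
              ∀ n : ℕ, ι₀.symm ((qExpansion 1 ⇑(iota (W.conductorNorm ℤ) (W.conductorNorm ℤ * p) 1 k
                  (mul_dvd_mul_left _ (one_dvd _)) g - ((qExpansion 1 ⇑g).coeff p - u) •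
                  iota (W.conductorNorm ℤ) (W.conductorNorm ℤ * p) p k dvd_rfl g)).coeff n) =
                algebraMap ℚ_[p] (PadicAlgCl p) (padicEval (A n) ((1 + (p : ℚ_[p])) ^ (k - 2) - 1)))) ∧
        (∀ (ι₀ : PadicAlgCl p ≃+* ℂ) (k : ℤ)
          (g : CuspForm (CongruenceSubgroup.Gamma0 (W.conductorNorm ℤ)) k),
          2 < k → ((p : ℤ) - 1) ∣ (k - 2) → IsNewform0 g →
          ‖ι₀.symm ((qExpansion 1 ⇑g).coeff p)‖ = 1 →
          (∀ ℓ : ℕ, ℓ.Prime → ¬ ℓ ∣ W.conductorNorm ℤ * p →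
            ‖ι₀.symm ((qExpansion 1 ⇑g).coeff ℓ) - ((W.frobeniusTrace ℓ : ℤ) : PadicAlgCl p)‖ < 1) →
          ∃ u : ℂ, u ^ 2 - (qExpansion 1 ⇑g).coeff p * u + (p : ℂ) ^ (k - 1) = 0 ∧
            ∀ n : ℕ, ι₀.symm ((qExpansion 1 ⇑(iota (W.conductorNorm ℤ) (W.conductorNorm ℤ * p) 1 k
                (mul_dvd_mul_left _ (one_dvd _)) g - ((qExpansion 1 ⇑g).coeff p - u) •
                iota (W.conductorNorm ℤ) (W.conductorNorm ℤ * p) p k dvd_rfl g)).coeff n) =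
              algebraMap ℚ_[p] (PadicAlgCl p) (padicEval (A n) ((1 + (p : ℚ_[p])) ^ (k - 2) - 1))))
    (hKitagawa : ∀ (W : WeierstrassCurve ℚ) [W.IsElliptic] [W.IsGloballyMinimal]
      (_ : NeZero (W.conductorNorm ℤ)) (p : ℕ) [Fact p.Prime], 5 ≤ p → W.HasGoodReductionAtPrime p →
      ¬ (p : ℤ) ∣ W.frobeniusTrace p → ∀ A : ℕ → PowerSeries ℚ_[p],
      ((∀ n, IsPadicInt (A n)) ∧
          (∀ n : ℕ, PowerSeries.constantCoeff (A n) =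
            ((W.LFunction n : ℤ) : ℚ_[p]) -
              (((W.LFunction p : ℤ) : ℚ_[p]) - (unitRoot W p : ℚ_[p])) *
                (if p ∣ n then ((W.LFunction (n / p) : ℤ) : ℚ_[p]) else 0)) ∧
          (∀ k : ℤ, 2 < k → ((p : ℤ) - 1) ∣ (k - 2) →
            ∃ (g : CuspForm (CongruenceSubgroup.Gamma0 (W.conductorNorm ℤ)) k)
              (ι₀ : PadicAlgCl p ≃+* ℂ) (u : ℂ), IsNewform0 g ∧
              u ^ 2 - (qExpansion 1 ⇑g).coeff p * u + (p : ℂ) ^ (k - 1) = 0 ∧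
              ∀ n : ℕ, ι₀.symm ((qExpansion 1 ⇑(iota (W.conductorNorm ℤ) (W.conductorNorm ℤ * p) 1 k
                  (mul_dvd_mul_left _ (one_dvd _)) g - ((qExpansion 1 ⇑g).coeff p - u) •
                  iota (W.conductorNorm ℤ) (W.conductorNorm ℤ * p) p k dvd_rfl g)).coeff n) =
                algebraMap ℚ_[p] (PadicAlgCl p) (padicEval (A n) ((1 + (p : ℚ_[p])) ^ (k - 2) - 1)))) →
      ∃ F : MvPowerSeries (Fin 2) ℚ_[p], IsPadicInt F ∧
        (∀ f : CuspForm (CongruenceSubgroup.Gamma0 (W.conductorNorm ℤ)) 2, IsNewformOf W f →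
          ∃ c : PadicAlgCl p, c ≠ 0 ∧ ∀ i : ℕ,
            algebraMap ℚ_[p] (PadicAlgCl p) (MvPowerSeries.coeff (Finsupp.single 1 i) F) =
              c * algebraMap ℚ_[p] (PadicAlgCl p)
                (PowerSeries.coeff i (padicLFunction f (unitRoot W p : ℚ_[p])))) ∧
        (∀ (ι₀ : PadicAlgCl p ≃+* ℂ) (k : ℤ)
          (g : CuspForm (CongruenceSubgroup.Gamma0 (W.conductorNorm ℤ)) k) (u : ℂ),
          2 < k → ((p : ℤ) - 1) ∣ (k - 2) → IsNewform0 g →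
          u ^ 2 - (qExpansion 1 ⇑g).coeff p * u + (p : ℂ) ^ (k - 1) = 0 →
          (∀ n : ℕ, ι₀.symm ((qExpansion 1 ⇑(iota (W.conductorNorm ℤ) (W.conductorNorm ℤ * p) 1 k
              (mul_dvd_mul_left _ (one_dvd _)) g - ((qExpansion 1 ⇑g).coeff p - u) •
              iota (W.conductorNorm ℤ) (W.conductorNorm ℤ * p) p k dvd_rfl g)).coeff n) =
            algebraMap ℚ_[p] (PadicAlgCl p) (padicEval (A n) ((1 + (p : ℚ_[p])) ^ (k - 2) - 1))) →
          ∃ (Per : PadicAlgCl p) (Ω : ℂ), Per ≠ 0 ∧ Ω ≠ 0 ∧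
            ∀ n : ℕ, 0 < n → (n : ℤ) < k → (p - 1) ∣ (n - 1) →
              algebraMap ℚ_[p] (PadicAlgCl p)
                  (padicEval₂ F ((1 + (p : ℚ_[p])) ^ (k - 2) - 1) ((1 + (p : ℚ_[p])) ^ (n - 1) - 1)) =
                Per * ι₀.symm ((1 - (p : ℂ) ^ (n - 1) / u) *
                  ((2 * Real.pi : ℂ) ^ n *
                    completedLValue
                      (iota (W.conductorNorm ℤ) (W.conductorNorm ℤ * p) 1 k
                          (mul_dvd_mul_left _ (one_dvd _)) g -
                        ((qExpansion 1 ⇑g).coeff p - u) •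
                          iota (W.conductorNorm ℤ) (W.conductorNorm ℤ * p) p k dvd_rfl g) n) /
                  ((2 * Real.pi * Complex.I) ^ (n - 1) * Ω)))) :
    greenbergStevens_kitagawa_twoVariable_interpolation :=
  greenbergStevens_kitagawa_twoVariable_interpolation_of_core (core_of_hidaFamily_of_kitagawa hHida hKitagawa)

end Reduction

/-! ### The interpolation clause in the normalisation of the weight-`k` fibre

The one-variable (weight-`k`) fibre of the two-variable interpolation is now a theorem of the tree
(`Literature.NumberTheory.EllipticCurves.MazurTateTeitelbaumWeightKMember`,
`exists_mtt_powerSeries_weightK_member'`, which imports THIS file): for every `ι₀`-rational ordinary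
member `(k, g, u)` there is a bounded `L_k ∈ ℚ_p⟦T⟧` with
`L_k((1+p)^{n−1} − 1) = ι₀⁻¹((1 − p^{n−1}/u)(1 − p^{k−1−n}/u) · Im(iⁿΛ(g, n))/Ω⁻_g)` at the critical
`0 < n < k`, `(p − 1) ∣ (n − 1)`.  What `hKitagawa` asserts beyond it is the PATCHING of these rows
into one `F ∈ ℤ_p⟦X, Y⟧` (Greenberg–Stevens 1993, Thm. 5.13: `ρ_k(μ_*) = λ(k) μ_{F_k}`; Kitagawa 1994,
Thm. 1.1).  `kitagawa_of_patching` records that `hKitagawa` follows from the same statement with its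
interpolation clause written in the fibre's normalisation (`hPatch`: the value of `F` at
`(x_k, y_n)` is `c_k · ι₀⁻¹((1 − p^{n−1}/u)(1 − p^{k−1−n}/u) · Im(iⁿΛ(g, n))/Ωm)` for a constant
`c_k ≠ 0` and a real `Ωm ≠ 0`), by the Euler factor of the `p`-stabilisation
(`completedLValue_pStabilisation_unitRoot`) and the bookkeeping
`Im(iⁿΛ)/Ωm = (2π)ⁿΛ/((2πi)^{n−1} · 2πΩm)` for odd `n` (`Λ(g, n)` real). -/

section Patching

/-- `(2π)ⁿ Λ / ((2πi)^{n−1} (2π Ωm)) = (Im (iⁿ Λ')) / Ωm` when `n` is odd, `iⁿΛ'` is purely imaginary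
and `Λ = Λ'`-up-to the given factor: the scalar bookkeeping behind `kitagawa_of_patching`. [folklore] -/
theorem two_pi_pow_mul_div_eq_im_div {n : ℕ} (hn : Odd n) (z : ℂ) (hz : (Complex.I ^ n * z).re = 0)
    {Ωm : ℝ} (hΩm : Ωm ≠ 0) :
    (2 * Real.pi : ℂ) ^ n * z / ((2 * Real.pi * Complex.I) ^ (n - 1) * (2 * Real.pi * Ωm)) =
      ((((Complex.I ^ n * z).im / Ωm : ℝ)) : ℂ) := by
  have him : ((((Complex.I ^ n * z).im : ℝ)) : ℂ) = -Complex.I * (Complex.I ^ n * z) :=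
    Complex.ext (by simp) (by simp [hz])
  rw [Complex.ofReal_div, him]
  obtain ⟨m, rfl⟩ := hn
  have hπ : (Real.pi : ℂ) ≠ 0 := by exact_mod_cast Real.pi_pos.ne'
  have hΩ : (Ωm : ℂ) ≠ 0 := by exact_mod_cast hΩm
  have hI2m : Complex.I ^ (2 * m) = (-1) ^ m := by rw [pow_mul, I_sq]
  have hI : Complex.I ^ (2 * m + 1) = (-1) ^ m * Complex.I := by rw [pow_succ, hI2m]
  have h1 : ((-1 : ℂ) ^ m) * (-1) ^ m = 1 := by rw [← mul_pow, neg_one_mul, neg_neg, one_pow]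
  have hm1 : ((-1 : ℂ) ^ m) ≠ 0 := pow_ne_zero _ (neg_ne_zero.mpr one_ne_zero)
  rw [Nat.add_sub_cancel]
  simp only [mul_pow, hI2m, hI]
  field_simp
  linear_combination ((2 : ℂ) ^ (2 * m + 1) * (Real.pi : ℂ) ^ (2 * m + 1) * z * ((-1 : ℂ) ^ m) ^ 2) * I_sq
    - ((2 : ℂ) ^ (2 * m + 1) * (Real.pi : ℂ) ^ (2 * m + 1) * z) * h1

/-- **`hKitagawa` from its fibre-normalised form.**  If the two-variable interpolation holds with
the interpolation clause written as
`F(x_k, y_n) = c_k · ι₀⁻¹((1 − p^{n−1}/u)(1 − p^{k−1−n}/u) · Im(iⁿ Λ(g, n))/Ωm)` (`c_k ∈ ℚ̄_p^×`,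
`Ωm ∈ ℝ^×`; the normalisation of the weight-`k` Mazur–Tate–Teitelbaum fibre
`exists_mtt_powerSeries_weightK_member'`), then it holds in the normalisation of
`core_of_hidaFamily_of_kitagawa` (`Per = c_k`, `Ω = 2πΩm`), because
`Λ(ι₁g − (a_p − u)ι_pg, n) = (1 − p^{k−1−n}/u) Λ(g, n)` (`completedLValue_pStabilisation_unitRoot`)
and `(2π)ⁿΛ(g, n)/((2πi)^{n−1} · 2πΩm) = Im(iⁿΛ(g, n))/Ωm` for the odd critical `n`
(`two_pi_pow_mul_div_eq_im_div`; `iⁿΛ(g, n) ∈ iℝ` as `g` has real coefficients). [folklore] -/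
theorem kitagawa_of_patching
    (hPatch : ∀ (W : WeierstrassCurve ℚ) [W.IsElliptic] [W.IsGloballyMinimal]
      (_ : NeZero (W.conductorNorm ℤ)) (p : ℕ) [Fact p.Prime], 5 ≤ p → W.HasGoodReductionAtPrime p →
      ¬ (p : ℤ) ∣ W.frobeniusTrace p → ∀ A : ℕ → PowerSeries ℚ_[p],
      ((∀ n, IsPadicInt (A n)) ∧
          (∀ n : ℕ, PowerSeries.constantCoeff (A n) =
            ((W.LFunction n : ℤ) : ℚ_[p]) -
              (((W.LFunction p : ℤ) : ℚ_[p]) - (unitRoot W p : ℚ_[p])) *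
                (if p ∣ n then ((W.LFunction (n / p) : ℤ) : ℚ_[p]) else 0)) ∧
          (∀ k : ℤ, 2 < k → ((p : ℤ) - 1) ∣ (k - 2) →
            ∃ (g : CuspForm (CongruenceSubgroup.Gamma0 (W.conductorNorm ℤ)) k)
              (ι₀ : PadicAlgCl p ≃+* ℂ) (u : ℂ), IsNewform0 g ∧
              u ^ 2 - (qExpansion 1 ⇑g).coeff p * u + (p : ℂ) ^ (k - 1) = 0 ∧
              ∀ n : ℕ, ι₀.symm ((qExpansion 1 ⇑(iota (W.conductorNorm ℤ) (W.conductorNorm ℤ * p) 1 k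
                  (mul_dvd_mul_left _ (one_dvd _)) g - ((qExpansion 1 ⇑g).coeff p - u) •
                  iota (W.conductorNorm ℤ) (W.conductorNorm ℤ * p) p k dvd_rfl g)).coeff n) =
                algebraMap ℚ_[p] (PadicAlgCl p) (padicEval (A n) ((1 + (p : ℚ_[p])) ^ (k - 2) - 1)))) →
      ∃ F : MvPowerSeries (Fin 2) ℚ_[p], IsPadicInt F ∧
        (∀ f : CuspForm (CongruenceSubgroup.Gamma0 (W.conductorNorm ℤ)) 2, IsNewformOf W f →
          ∃ c : PadicAlgCl p, c ≠ 0 ∧ ∀ i : ℕ,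
            algebraMap ℚ_[p] (PadicAlgCl p) (MvPowerSeries.coeff (Finsupp.single 1 i) F) =
              c * algebraMap ℚ_[p] (PadicAlgCl p)
                (PowerSeries.coeff i (padicLFunction f (unitRoot W p : ℚ_[p])))) ∧
        (∀ (ι₀ : PadicAlgCl p ≃+* ℂ) (k : ℤ)
          (g : CuspForm (CongruenceSubgroup.Gamma0 (W.conductorNorm ℤ)) k) (u : ℂ),
          2 < k → ((p : ℤ) - 1) ∣ (k - 2) → IsNewform0 g →
          u ^ 2 - (qExpansion 1 ⇑g).coeff p * u + (p : ℂ) ^ (k - 1) = 0 →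
          (∀ n : ℕ, ι₀.symm ((qExpansion 1 ⇑(iota (W.conductorNorm ℤ) (W.conductorNorm ℤ * p) 1 k
              (mul_dvd_mul_left _ (one_dvd _)) g - ((qExpansion 1 ⇑g).coeff p - u) •
              iota (W.conductorNorm ℤ) (W.conductorNorm ℤ * p) p k dvd_rfl g)).coeff n) =
            algebraMap ℚ_[p] (PadicAlgCl p) (padicEval (A n) ((1 + (p : ℚ_[p])) ^ (k - 2) - 1))) →
          ∃ (c : PadicAlgCl p) (Ωm : ℝ), c ≠ 0 ∧ Ωm ≠ 0 ∧
            ∀ n : ℕ, 0 < n → (n : ℤ) < k → (p - 1) ∣ (n - 1) →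
              algebraMap ℚ_[p] (PadicAlgCl p)
                  (padicEval₂ F ((1 + (p : ℚ_[p])) ^ (k - 2) - 1) ((1 + (p : ℚ_[p])) ^ (n - 1) - 1)) =
                c * ι₀.symm ((1 - (p : ℂ) ^ (n - 1) / u) * (1 - (p : ℂ) ^ (k - 1 - n) / u) *
                  ((((Complex.I ^ n * completedLValue g n).im / Ωm : ℝ)) : ℂ)))) :
    ∀ (W : WeierstrassCurve ℚ) [W.IsElliptic] [W.IsGloballyMinimal]
      (_ : NeZero (W.conductorNorm ℤ)) (p : ℕ) [Fact p.Prime], 5 ≤ p → W.HasGoodReductionAtPrime p →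
      ¬ (p : ℤ) ∣ W.frobeniusTrace p → ∀ A : ℕ → PowerSeries ℚ_[p],
      ((∀ n, IsPadicInt (A n)) ∧
          (∀ n : ℕ, PowerSeries.constantCoeff (A n) =
            ((W.LFunction n : ℤ) : ℚ_[p]) -
              (((W.LFunction p : ℤ) : ℚ_[p]) - (unitRoot W p : ℚ_[p])) *
                (if p ∣ n then ((W.LFunction (n / p) : ℤ) : ℚ_[p]) else 0)) ∧
          (∀ k : ℤ, 2 < k → ((p : ℤ) - 1) ∣ (k - 2) →
            ∃ (g : CuspForm (CongruenceSubgroup.Gamma0 (W.conductorNorm ℤ)) k)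
              (ι₀ : PadicAlgCl p ≃+* ℂ) (u : ℂ), IsNewform0 g ∧
              u ^ 2 - (qExpansion 1 ⇑g).coeff p * u + (p : ℂ) ^ (k - 1) = 0 ∧
              ∀ n : ℕ, ι₀.symm ((qExpansion 1 ⇑(iota (W.conductorNorm ℤ) (W.conductorNorm ℤ * p) 1 k
                  (mul_dvd_mul_left _ (one_dvd _)) g - ((qExpansion 1 ⇑g).coeff p - u) •
                  iota (W.conductorNorm ℤ) (W.conductorNorm ℤ * p) p k dvd_rfl g)).coeff n) =
                algebraMap ℚ_[p] (PadicAlgCl p) (padicEval (A n) ((1 + (p : ℚ_[p])) ^ (k - 2) - 1)))) →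
      ∃ F : MvPowerSeries (Fin 2) ℚ_[p], IsPadicInt F ∧
        (∀ f : CuspForm (CongruenceSubgroup.Gamma0 (W.conductorNorm ℤ)) 2, IsNewformOf W f →
          ∃ c : PadicAlgCl p, c ≠ 0 ∧ ∀ i : ℕ,
            algebraMap ℚ_[p] (PadicAlgCl p) (MvPowerSeries.coeff (Finsupp.single 1 i) F) =
              c * algebraMap ℚ_[p] (PadicAlgCl p)
                (PowerSeries.coeff i (padicLFunction f (unitRoot W p : ℚ_[p])))) ∧
        (∀ (ι₀ : PadicAlgCl p ≃+* ℂ) (k : ℤ)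
          (g : CuspForm (CongruenceSubgroup.Gamma0 (W.conductorNorm ℤ)) k) (u : ℂ),
          2 < k → ((p : ℤ) - 1) ∣ (k - 2) → IsNewform0 g →
          u ^ 2 - (qExpansion 1 ⇑g).coeff p * u + (p : ℂ) ^ (k - 1) = 0 →
          (∀ n : ℕ, ι₀.symm ((qExpansion 1 ⇑(iota (W.conductorNorm ℤ) (W.conductorNorm ℤ * p) 1 k
              (mul_dvd_mul_left _ (one_dvd _)) g - ((qExpansion 1 ⇑g).coeff p - u) •
              iota (W.conductorNorm ℤ) (W.conductorNorm ℤ * p) p k dvd_rfl g)).coeff n) =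
            algebraMap ℚ_[p] (PadicAlgCl p) (padicEval (A n) ((1 + (p : ℚ_[p])) ^ (k - 2) - 1))) →
          ∃ (Per : PadicAlgCl p) (Ω : ℂ), Per ≠ 0 ∧ Ω ≠ 0 ∧
            ∀ n : ℕ, 0 < n → (n : ℤ) < k → (p - 1) ∣ (n - 1) →
              algebraMap ℚ_[p] (PadicAlgCl p)
                  (padicEval₂ F ((1 + (p : ℚ_[p])) ^ (k - 2) - 1) ((1 + (p : ℚ_[p])) ^ (n - 1) - 1)) =
                Per * ι₀.symm ((1 - (p : ℂ) ^ (n - 1) / u) *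
                  ((2 * Real.pi : ℂ) ^ n *
                    completedLValue
                      (iota (W.conductorNorm ℤ) (W.conductorNorm ℤ * p) 1 k
                          (mul_dvd_mul_left _ (one_dvd _)) g -
                        ((qExpansion 1 ⇑g).coeff p - u) •
                          iota (W.conductorNorm ℤ) (W.conductorNorm ℤ * p) p k dvd_rfl g) n) /
                  ((2 * Real.pi * Complex.I) ^ (n - 1) * Ω))) := by
  intro W _ _ hN p _ hp5 hgood hord A hFam
  obtain ⟨F, hint, hW2, hI⟩ := hPatch W hN p hp5 hgood hord A hFam
  refine ⟨F, hint, hW2, fun ι₀ k g u hk hpk hg hu hmem ↦ ?_⟩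
  obtain ⟨c, Ωm, hc, hΩm, hval⟩ := hI ι₀ k g u hk hpk hg hu hmem
  have hp : p.Prime := Fact.out
  have hp2 : p ≠ 2 := by omega
  have hπΩ : (2 * Real.pi * Ωm : ℂ) ≠ 0 :=
    mul_ne_zero (by exact_mod_cast (mul_pos two_pos Real.pi_pos).ne') (by exact_mod_cast hΩm)
  refine ⟨c, 2 * Real.pi * Ωm, hc, hπΩ, fun n hn hnk hpn ↦ ?_⟩
  rw [hval n hn hnk hpn]
  congr 1
  congr 1
  -- `u ≠ 0` from the root equation
  have hu0 : u ≠ 0 := by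
    rintro rfl
    have : (p : ℂ) ^ (k - 1) = 0 := by simpa using hu
    exact zpow_ne_zero _ (by exact_mod_cast hp.ne_zero) this
  rw [completedLValue_pStabilisation_unitRoot (by omega) g hu hu0 _ _ hn]
  -- `n` is odd and `iⁿ Λ(g, n)` is purely imaginary (`g` has real coefficients)
  have heven : Even (n - 1) := by
    obtain ⟨d, hd⟩ := hpn
    rw [hd]
    exact (hp.even_sub_one hp2).mul_right d
  have hodd : Odd n := by
    rw [← Nat.sub_add_cancel hn]
    exact heven.add_one
  obtain ⟨m, rfl⟩ : ∃ m : ℕ, k = (m : ℤ) + 2 := ⟨(k - 2).toNat, by omega⟩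
  have hreal : HasRealCoefficients g := hg.cuspCoeff_im_eq_zero
  have hz : (Complex.I ^ n * completedLValue g n).re = 0 := by
    have h := (I_pow_mul_completedLValue_re_im g hreal (n - 1)).2 heven
    rwa [Nat.sub_add_cancel hn] at h
  rw [← two_pi_pow_mul_div_eq_im_div hodd _ hz hΩm]
  ring

/-- **The named fact, closed modulo `hHida ∧ hPatch`** — the same residue as
`greenbergStevens_kitagawa_twoVariable_interpolation_of_hidaFamily_of_kitagawa`, with Kitagawa's
interpolation clause in the normalisation of the (proved) weight-`k` Mazur–Tate–Teitelbaum fibre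
`exists_mtt_powerSeries_weightK_member'`; what `hPatch` asserts beyond that theorem is the existence of
ONE integral `F ∈ ℤ_p⟦X, Y⟧` whose rows at the arithmetic points are these fibres up to units and whose
row at `X = 0` is the tree's `L_p(E, T)` (Greenberg–Stevens 1993, Thm. 5.13 / Kitagawa 1994,
Thm. 1.1; the two-variable patching, not in the tree). [cite: GreenbergStevens1993, Thm. 5.13, Thm. 5.15] -/
theorem greenbergStevens_kitagawa_twoVariable_interpolation_of_hidaFamily_of_patching
    (hHida : ∀ (W : WeierstrassCurve ℚ) [W.IsElliptic] [W.IsGloballyMinimal]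
      (_ : NeZero (W.conductorNorm ℤ)) (p : ℕ) [Fact p.Prime], 5 ≤ p → W.HasGoodReductionAtPrime p →
      ¬ (p : ℤ) ∣ W.frobeniusTrace p → W.HasSurjectiveModNGaloisRep p →
      (∀ (M : ℕ) (_ : NeZero M) (g : CuspForm (CongruenceSubgroup.Gamma0 M) 2)
        (ι : coeffField g →+* PadicAlgCl p), M ∣ W.conductorNorm ℤ * p → IsNewform0 g →
        ‖ι ⟨(qExpansion 1 ⇑g).coeff p, coeff_mem_coeffField g p⟩‖ = 1 →
        (∀ ℓ : ℕ, ℓ.Prime → ¬ ℓ ∣ W.conductorNorm ℤ * p →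
          ‖ι ⟨(qExpansion 1 ⇑g).coeff ℓ, coeff_mem_coeffField g ℓ⟩ -
            ((W.frobeniusTrace ℓ : ℤ) : PadicAlgCl p)‖ < 1) →
        M = W.conductorNorm ℤ ∧ ∀ n : ℕ, (qExpansion 1 ⇑g).coeff n = ((W.LFunction n : ℤ) : ℂ)) →
      ∃ A : ℕ → PowerSeries ℚ_[p],
        ((∀ n, IsPadicInt (A n)) ∧
          (∀ n : ℕ, PowerSeries.constantCoeff (A n) =
            ((W.LFunction n : ℤ) : ℚ_[p]) -
              (((W.LFunction p : ℤ) : ℚ_[p]) - (unitRoot W p : ℚ_[p])) *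
                (if p ∣ n then ((W.LFunction (n / p) : ℤ) : ℚ_[p]) else 0)) ∧
          (∀ k : ℤ, 2 < k → ((p : ℤ) - 1) ∣ (k - 2) →
            ∃ (g : CuspForm (CongruenceSubgroup.Gamma0 (W.conductorNorm ℤ)) k)
              (ι₀ : PadicAlgCl p ≃+* ℂ) (u : ℂ), IsNewform0 g ∧
              u ^ 2 - (qExpansion 1 ⇑g).coeff p * u + (p : ℂ) ^ (k - 1) = 0 ∧
              ∀ n : ℕ, ι₀.symm ((qExpansion 1 ⇑(iota (W.conductorNorm ℤ) (W.conductorNorm ℤ * p) 1 k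
                  (mul_dvd_mul_left _ (one_dvd _)) g - ((qExpansion 1 ⇑g).coeff p - u) •
                  iota (W.conductorNorm ℤ) (W.conductorNorm ℤ * p) p k dvd_rfl g)).coeff n) =
                algebraMap ℚ_[p] (PadicAlgCl p) (padicEval (A n) ((1 + (p : ℚ_[p])) ^ (k - 2) - 1)))) ∧
        (∀ (ι₀ : PadicAlgCl p ≃+* ℂ) (k : ℤ)
          (g : CuspForm (CongruenceSubgroup.Gamma0 (W.conductorNorm ℤ)) k),
          2 < k → ((p : ℤ) - 1) ∣ (k - 2) → IsNewform0 g →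
          ‖ι₀.symm ((qExpansion 1 ⇑g).coeff p)‖ = 1 →
          (∀ ℓ : ℕ, ℓ.Prime → ¬ ℓ ∣ W.conductorNorm ℤ * p →
            ‖ι₀.symm ((qExpansion 1 ⇑g).coeff ℓ) - ((W.frobeniusTrace ℓ : ℤ) : PadicAlgCl p)‖ < 1) →
          ∃ u : ℂ, u ^ 2 - (qExpansion 1 ⇑g).coeff p * u + (p : ℂ) ^ (k - 1) = 0 ∧
            ∀ n : ℕ, ι₀.symm ((qExpansion 1 ⇑(iota (W.conductorNorm ℤ) (W.conductorNorm ℤ * p) 1 k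
                (mul_dvd_mul_left _ (one_dvd _)) g - ((qExpansion 1 ⇑g).coeff p - u) •
                iota (W.conductorNorm ℤ) (W.conductorNorm ℤ * p) p k dvd_rfl g)).coeff n) =
              algebraMap ℚ_[p] (PadicAlgCl p) (padicEval (A n) ((1 + (p : ℚ_[p])) ^ (k - 2) - 1))))
    (hPatch : ∀ (W : WeierstrassCurve ℚ) [W.IsElliptic] [W.IsGloballyMinimal]
      (_ : NeZero (W.conductorNorm ℤ)) (p : ℕ) [Fact p.Prime], 5 ≤ p → W.HasGoodReductionAtPrime p →
      ¬ (p : ℤ) ∣ W.frobeniusTrace p → ∀ A : ℕ → PowerSeries ℚ_[p],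
      ((∀ n, IsPadicInt (A n)) ∧
          (∀ n : ℕ, PowerSeries.constantCoeff (A n) =
            ((W.LFunction n : ℤ) : ℚ_[p]) -
              (((W.LFunction p : ℤ) : ℚ_[p]) - (unitRoot W p : ℚ_[p])) *
                (if p ∣ n then ((W.LFunction (n / p) : ℤ) : ℚ_[p]) else 0)) ∧
          (∀ k : ℤ, 2 < k → ((p : ℤ) - 1) ∣ (k - 2) →
            ∃ (g : CuspForm (CongruenceSubgroup.Gamma0 (W.conductorNorm ℤ)) k)
              (ι₀ : PadicAlgCl p ≃+* ℂ) (u : ℂ), IsNewform0 g ∧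
              u ^ 2 - (qExpansion 1 ⇑g).coeff p * u + (p : ℂ) ^ (k - 1) = 0 ∧
              ∀ n : ℕ, ι₀.symm ((qExpansion 1 ⇑(iota (W.conductorNorm ℤ) (W.conductorNorm ℤ * p) 1 k
                  (mul_dvd_mul_left _ (one_dvd _)) g - ((qExpansion 1 ⇑g).coeff p - u) •
                  iota (W.conductorNorm ℤ) (W.conductorNorm ℤ * p) p k dvd_rfl g)).coeff n) =
                algebraMap ℚ_[p] (PadicAlgCl p) (padicEval (A n) ((1 + (p : ℚ_[p])) ^ (k - 2) - 1)))) →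
      ∃ F : MvPowerSeries (Fin 2) ℚ_[p], IsPadicInt F ∧
        (∀ f : CuspForm (CongruenceSubgroup.Gamma0 (W.conductorNorm ℤ)) 2, IsNewformOf W f →
          ∃ c : PadicAlgCl p, c ≠ 0 ∧ ∀ i : ℕ,
            algebraMap ℚ_[p] (PadicAlgCl p) (MvPowerSeries.coeff (Finsupp.single 1 i) F) =
              c * algebraMap ℚ_[p] (PadicAlgCl p)
                (PowerSeries.coeff i (padicLFunction f (unitRoot W p : ℚ_[p])))) ∧
        (∀ (ι₀ : PadicAlgCl p ≃+* ℂ) (k : ℤ)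
          (g : CuspForm (CongruenceSubgroup.Gamma0 (W.conductorNorm ℤ)) k) (u : ℂ),
          2 < k → ((p : ℤ) - 1) ∣ (k - 2) → IsNewform0 g →
          u ^ 2 - (qExpansion 1 ⇑g).coeff p * u + (p : ℂ) ^ (k - 1) = 0 →
          (∀ n : ℕ, ι₀.symm ((qExpansion 1 ⇑(iota (W.conductorNorm ℤ) (W.conductorNorm ℤ * p) 1 k
              (mul_dvd_mul_left _ (one_dvd _)) g - ((qExpansion 1 ⇑g).coeff p - u) •
              iota (W.conductorNorm ℤ) (W.conductorNorm ℤ * p) p k dvd_rfl g)).coeff n) =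
            algebraMap ℚ_[p] (PadicAlgCl p) (padicEval (A n) ((1 + (p : ℚ_[p])) ^ (k - 2) - 1))) →
          ∃ (c : PadicAlgCl p) (Ωm : ℝ), c ≠ 0 ∧ Ωm ≠ 0 ∧
            ∀ n : ℕ, 0 < n → (n : ℤ) < k → (p - 1) ∣ (n - 1) →
              algebraMap ℚ_[p] (PadicAlgCl p)
                  (padicEval₂ F ((1 + (p : ℚ_[p])) ^ (k - 2) - 1) ((1 + (p : ℚ_[p])) ^ (n - 1) - 1)) =
                c * ι₀.symm ((1 - (p : ℂ) ^ (n - 1) / u) * (1 - (p : ℂ) ^ (k - 1 - n) / u) *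
                  ((((Complex.I ^ n * completedLValue g n).im / Ωm : ℝ)) : ℂ)))) :
    greenbergStevens_kitagawa_twoVariable_interpolation :=
  greenbergStevens_kitagawa_twoVariable_interpolation_of_hidaFamily_of_kitagawa hHida
    (kitagawa_of_patching hPatch)

end Patching

end Literature.NumberTheory.EllipticCurves

end
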